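import Summits.AtomisticToContinuum.HydrodynamicLimit.Theses.InformationPercolationEngine
import Summits.AtomisticToContinuum.HydrodynamicLimit.Theorems.JParityClosureLocalSecondLawLedgerDefs
import Literature.Analysis.FluidPDE.CollisionWeakForm

/-!
# Line `contact-asymmetry-information` — checked skeleton for the crux `LocalSecondLaw`
(stmt-AtomisticToContinuum-13081; route InformationPercolationEngine, shared with JParityClosure — the two decls are
`Iff.rfl`-equal, `Cruxes/LocalSecondLaw/Restatement.jParity_iff_ipe`)

crux-plan seat `planner-cruxplan-stmt-AtomisticToContinuum-13081-contact-asymmetry-in-0`, 2026-08-17.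
Idea card `Cruxes/LocalSecondLaw/Ideas/contact-asymmetry-information.md` (round 2, ideator 5; triage r2: pass 2/3 —
TRIAGE-r2-2, TRIAGE-r2-3 (deciding) pass with sharpenings, TRIAGE-r2-1 fail (costume (iv)); every sharpening is acted on
below and listed in the line card `Lines/contact-asymmetry-information.md`).

## The line in one picture: ANNEALED → QUENCHED BY PINNING, and the contact-asymmetry split of the production

All earlier skeletons of this crux are PATHWISE (a functional of one realisation is split and each piece is asked to be
small in probability).  This line is ENSEMBLE-LEVEL: the crux's bad event `Bad = {I(z) + ∫H(ρ(0),θ(0))φ(0) < -η}` is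
shown improbable by CONDITIONING.  If `P_N(Bad) > δ`, pigeonhole `Bad` against a finite `η′`-net of coarse histories
(stub T `stub_historyNet`: tightness of `s ↦ (ρ_r, m_r, e_r)(Φₛz)` at fixed `r`); one cell `S = Bad ∩ Pin_j` has
`P_N(S) ≥ δ/(2M)`, and the conditioned law `ν_S = P_N(· | S)` is a BOUNDED TILT (`ν_S ≤ (2M/δ) P_N`) of the local Gibbs
law whose coarse histories are PINNED to within `η′` of one deterministic history.  For such laws every ensemble object
of kinetic theory exists: the one-particle density `f` (slice-wise in time), its kinetic entropy `h₁ = ∫ f log f dv`,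
and the CONTACT DENSITY `q` of the expected empirical collision measure on the contact bundle
`[0,τ] × 𝕋³ × (V3 × V3) × 𝕊²` (ordered pairs, PRE-collisional velocities, direction from the particle to its partner) —
all trace-free, characterised by duality against bounded test functions (`IsOneParticleDensity`, `IsContactDensity`).
The mean coarse fields `(ρ̄, m̄, ē)` of `ν_S` define the ENSEMBLE crux functional `𝓘[ν_S]` (`ensFunctional`, the crux
integrand at the mean fields, time part + transport part), and the line shows `𝓘[ν_S] + init_E ≥ -5η/6` by the
kinetic ledger

  `𝓘 + init_E = (𝒦 − P_R) + P_R + maxwellGap + fluxGap + initialGap`      (`ring`, all five are differences of reals)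

where `𝒦` (`kinWeakForm`) is the weak form of the smeared Résibois `H`-density `b_r ∗ h₁ + c₀ρ̄ + ρ̄ f_ex(ρ̄σ³)` with
its flux, and `P_R` (`prodR`) is HALF THE BOOKED PRODUCTION of the card's identity, instantiated on the real contact
bundle: `P_R = ½ ∫ φ̃ q (log b − log b∘R̂)`, `b = f(x,v) f(x+εω,w)`, `R̂(s,x,(v,w),ω) = (s,x,collide ω (v,w),−ω)` the
measure-preserving involution of the bundle (tree: `measurePreserving_collideSwap_prod`, `measurePreserving_swap_negDir`,
`collide_collide`, `collide_neg_dir` — PROVED here, `measurePreserving_Rhat`, `Rhat_involutive`).  The card's identity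
`bookedProduction = asymmetryInfo + oddLogCorrelation` and the Gibbs sign are PROVED here in the abstract (§ Kernel), and
the composition uses them through `prodR_ge_of_relativeOddChaos`: the POINTWISE, PARITY-RESOLVED, ONE-SIDED relative
odd-chaos hypothesis K1 (stub `stub_relativeOddChaos`, THE BET, typed sign-free as TRIAGE r2-1/r2-3 demand:
`(q∘R̂ − q)·ψ_odd ≥ −κ·½(q∘R̂ − q)(log q∘R̂ − log q) − e` a.e. on the bundle, `ψ = log q − log b`, `∫e ≤ η`, at a contrast
level `κ < 1` fixed right after `σ` — the card's `c = O(σ³)`) gives `P_R ≥ (1 − κ)·A − η ≥ −η` with `A = KL(qR̂‖q) ≥ 0`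
(and the BUDGET `(1 − κ)A ≤ 2P_R + η`, `asymR_le_of_relativeOddChaos`, proved) — everything R-EVEN (Enskog's `Y`,
excluded volume, the flux weight `|g·ω|`, every static structure) drops out of `ψ_odd` identically.  The four remaining
terms are the stubs
`stub_exchangePairing` (`𝒦 − P_R ≥ −η`: the exact first-marginal entropy balance `𝒲[b_r∗h₁, b_r∗j₁] = P_true` — no
commutator, the cone smearing is transposed onto `φ` — plus `P_true − P_R =` Résibois offset + collisional entropy-flux
pairing, cancelled by the configurational work `𝒲_C` à la EvenStressEnskog), `stub_maxwellisation` (time-`L¹`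
Maxwellisation of the `r`-smeared marginal of pinned tilted laws: `Hs(ρ̄,θ̄) − h̄_kin = −[Jensen defect] − KL(f̄‖M_f̄) ≤ 0`,
`f_ex` CANCELS), `stub_entropyFluxClosure` (the conductive kinetic entropy flux — the cubic closure the crux itself
implies) and `stub_initialMatching` (conditioning lemma + the `t = 0` LLN).  Finally stub Q `stub_pinnedRepresentation`
says that on a pinned cell at most half the mass has its PATHWISE functional more than `η/6` below the ensemble one —
but `S ⊆ Bad` forces all of `S` below, so `P_N(S) ≤ P_N(S)/2`, `P_N(S) = 0`, contradiction.  `LocalSecondLaw_of` is this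
argument, kernel-checked (pigeonhole in `ℝ≥0∞`, `Measure.restrict`, the abstract kernel, `ring`, `linarith`); `sorry`
only inside the seven `stub_*`.

## Stubs at a glance (registered; hardest: `stub_relativeOddChaos`)
* T  `stub_historyNet`          (M–L, provable; all `τ`; no chaos) — tightness of coarse histories at fixed `r`.
* Q  `stub_pinnedRepresentation` (L–XL; all `τ`) — pathwise vs ensemble functional on pinned cells; CARRIES the
     regular-range content every line must pay on the typed decl (cold populated balls S4, packing cap K5 — conceded
     NECESSARY by the card; recorded producer-less past `T`: `Lines/*-dead.md`, census D3/N2).  Flagged, not hidden.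
* S  `stub_exchangePairing`      (XL + L; all `τ`) — renormalised first-marginal entropy balance + Résibois offset ↔
     configurational work (EvenStressEnskog stmt-13079 by name); provides the densities `f`, `q` and their admissibility.
* K1 `stub_relativeOddChaos`     (THE BET; crux-sized; Boltzmann-hypothesis class; no producer at `τ ≥ T`).
* M  `stub_maxwellisation`       (XL; all `τ`) — time-`L¹` Maxwellisation of the smeared ENSEMBLE marginal of pinned
     tilted laws; the card DERIVES it (budget ⟸ K1 read upward, proved here; + K2 AsymmetryCoercivity + ensemble chaos +
     RateFloor stmt-13080) — foreseen layer-2 split, documented at the stub; the recorded-dead EMPIRICAL S3 is not restated.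
* K4 `stub_entropyFluxClosure`   (XL; all `τ`; HighMomentumCutoff class) — the weak cubic closure the crux implies.
* B′ `stub_initialMatching`      (M–L, provable with work) — conditioning lemma + `t = 0` LLN (+ landed B by name).
Reach: ALL `τ` as typed.  Under the restatement C′ (`Restatement.LocalSecondLawInBand`, `τ < T` + packing guard) Q's
range content is DensityCap stmt-13082 by name and the line is an alternative kinetic feed of the pre-shock sign.

## Disproof.lean (cycle 2, NO KILL) used
`localSecondLaw_false_without_lln` — honoured at `stub_initialMatching` (the only consumer of `TendstoHydroFieldsAt … 0`;
the Euler PDE beyond `t = 0` is used nowhere).  `localSecondLaw_false_without_support` — honoured: the support hypothesis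
is threaded to every ensemble stub (no terminal boundary term in `𝒦`).  `not_localSecondLawGapAt/StrictGap` — respected:
at every R̂-invariant contact law `A = 0`, K1 reads `0 ≥ −e`, no positive gap is claimed anywhere (`P_R ≥ −η` only).
`not_localSecondLawRAfterN/UniformN` — respected: frame `∃ η′ ∃ r₀ ∀ r ∀ δ″ ∃ N₀(r, δ″)`, `N → ∞` at FIXED `r`; the net
size `M(r)` enters `δ″ = δ/(2M)` before `N₀`.  Disproof §(b) junk audit (honest `∫Hs` only below a packing cap) and §(d)
(EOS continuity, cold populated balls) live in stub Q, flagged there.  No stub is an instance of a landed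
`Theorems/LocalSecondLaw/Negative/*` lemma (those refute frame changes — LLN/support deletion, `r` after `N`, uniform
`N₀`, positive gaps — none of which occurs below).  `ledger negatives` (21, read 2026-08-17): 13479 (measurability twist) — every density
here is quantified with `Measurable` and the test classes are bounded measurable; 9236/9238/6610/6612 (small cells) —
`N → ∞` first; 14607 (exponential cubic tails) — K4 asks a weak limit, no rate; 17700/13733/9168/9218/9395/11470 unrelated.
-/

noncomputable section

open scoped BigOperators Topology Classical MeasureTheory ENNReal InnerProductSpace
open Filter Set MeasureTheory Function
open Literature.MathematicalPhysics.KineticTheory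
open Literature.Analysis.FluidPDE
open Summit.AtomisticToContinuum.HydrodynamicLimit.Theses
open Summit.AtomisticToContinuum.HydrodynamicLimit.Theorems.LocalSecondLawNegative
open Summit.AtomisticToContinuum.HydrodynamicLimit.Theorems.LocalSecondLawLedger

namespace Summit.AtomisticToContinuum.HydrodynamicLimit.Cruxes.LocalSecondLaw.ContactAsymmetryInformation

/-! ## § Kernel — the card's information identity and the sign from pointwise relative odd chaos (abstract, PROVED)

An abstract measure space `(X, μ)` with a `μ`-preserving measurable involution `J`; `q` a density (the contact law),
`b` a reference density (the product of one-particle marginals).  Texts of the three functionals and of the identity are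
those of the ideator's kernel-checked `Cruxes/LocalSecondLaw/IdeatorFiveSketch.lean` (round 2, k5); the new pieces are the
Jeffreys form of the asymmetry information, the odd-part bookkeeping and `bookedProduction_ge_of_pointwise`. -/

section Kernel

variable {X : Type*} [MeasurableSpace X]

/-- Booked surprisal production of the reference density `b` under the law of density `q`: `E_Q[log b − log (b ∘ J)]`. -/
def bookedProduction (μ : Measure X) (J : X → X) (q b : X → ℝ) : ℝ :=
  ∫ x, q x * (Real.log (b x) - Real.log (b (J x))) ∂μ

/-- J-asymmetry information `KL(QJ ‖ Q) = ∫ (q ∘ J) (log (q ∘ J) − log q)` (the ARROW-OF-TIME information of the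
contact law: how distinguishable time-reversed outgoing pairs are from incoming ones). -/
def asymmetryInfo (μ : Measure X) (J : X → X) (q : X → ℝ) : ℝ :=
  ∫ x, q (J x) * (Real.log (q (J x)) - Real.log (q x)) ∂μ

/-- Odd log-correlation term `∫ (q ∘ J − q) (log q − log b)` (the `Q`-mean of minus twice the J-odd part of the log
pair-correlation `log (q/b)`). -/
def oddLogCorrelation (μ : Measure X) (J : X → X) (q b : X → ℝ) : ℝ :=
  ∫ x, (q (J x) - q x) * (Real.log (q x) - Real.log (b x)) ∂μ

/-- The pointwise Jeffreys integrand `(q∘J − q)(log q∘J − log q)` — non-negative wherever `q`, `q∘J` are both positive or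
both zero; its integral is TWICE the asymmetry information (`integral_jeffreysIntegrand`). -/
def jeffreysIntegrand (J : X → X) (q : X → ℝ) (x : X) : ℝ :=
  (q (J x) - q x) * (Real.log (q (J x)) - Real.log (q x))

/-- The log pair-correlation `ψ = log q − log b` (up to J-even terms: `log g₂`). -/
def logCorr (q b : X → ℝ) (x : X) : ℝ := Real.log (q x) - Real.log (b x)

/-- J-odd part of a function, `g_odd = (g − g ∘ J)/2`. -/
def oddPart (J : X → X) (g : X → ℝ) (x : X) : ℝ := (g x - g (J x)) / 2

variable {μ : Measure X} {J : X → X} {q b : X → ℝ}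

/-- **The booked production is J-asymmetry information plus the odd log-correlation term** (exact; change of variables
under the `μ`-preserving involution `J`). [IdeatorFiveSketch, re-derived] -/
theorem bookedProduction_eq_asymmetryInfo_add_oddLogCorrelation
    (hJ : MeasurePreserving J μ μ) (hJJ : Involutive J)
    (h1 : Integrable (fun x => q x * Real.log (q x)) μ)
    (h2 : Integrable (fun x => q x * Real.log (b x)) μ)
    (h3 : Integrable (fun x => q (J x) * Real.log (q x)) μ)
    (h4 : Integrable (fun x => q (J x) * Real.log (b x)) μ) :
    bookedProduction μ J q b = asymmetryInfo μ J q + oddLogCorrelation μ J q b := by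
  have hJ2 : ∀ x, J (J x) = x := hJJ
  have hemb : MeasurableEmbedding J :=
    (MeasurableEquiv.ofInvolutive J hJJ hJ.measurable).measurableEmbedding
  have T1 : ∫ x, q (J x) * Real.log (q (J x)) ∂μ = ∫ x, q x * Real.log (q x) ∂μ :=
    hJ.integral_comp hemb (fun x => q x * Real.log (q x))
  have T2 : ∫ x, q x * Real.log (b (J x)) ∂μ = ∫ x, q (J x) * Real.log (b x) ∂μ := by
    have h := hJ.integral_comp hemb (fun x => q (J x) * Real.log (b x))
    simp only [hJ2] at h
    exact h
  have i1 : Integrable (fun x => q (J x) * Real.log (q (J x))) μ :=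
    (hJ.integrable_comp_emb hemb (g := fun x => q x * Real.log (q x))).2 h1
  have i5 : Integrable (fun x => q x * Real.log (b (J x))) μ := by
    have h := (hJ.integrable_comp_emb hemb (g := fun x => q (J x) * Real.log (b x))).2 h4
    refine h.congr (Filter.Eventually.of_forall fun x => ?_)
    simp [Function.comp, hJ2]
  have eP : bookedProduction μ J q b
      = (∫ x, q x * Real.log (b x) ∂μ) - ∫ x, q x * Real.log (b (J x)) ∂μ := by
    unfold bookedProduction
    rw [← integral_sub h2 i5]
    congr 1; ext x; ring
  have eA : asymmetryInfo μ J q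
      = (∫ x, q (J x) * Real.log (q (J x)) ∂μ) - ∫ x, q (J x) * Real.log (q x) ∂μ := by
    unfold asymmetryInfo
    rw [← integral_sub i1 h3]
    congr 1; ext x; ring
  have i34 : Integrable (fun x => q (J x) * Real.log (q x) - q (J x) * Real.log (b x)) μ :=
    h3.sub h4
  have i12 : Integrable (fun x => q x * Real.log (q x) - q x * Real.log (b x)) μ := h1.sub h2
  have eX : oddLogCorrelation μ J q b
      = ((∫ x, q (J x) * Real.log (q x) ∂μ) - ∫ x, q (J x) * Real.log (b x) ∂μ)
        - ((∫ x, q x * Real.log (q x) ∂μ) - ∫ x, q x * Real.log (b x) ∂μ) := by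
    unfold oddLogCorrelation
    have e1 : (fun x => (q (J x) - q x) * (Real.log (q x) - Real.log (b x)))
        = fun x => (q (J x) * Real.log (q x) - q (J x) * Real.log (b x))
            - (q x * Real.log (q x) - q x * Real.log (b x)) := by
      ext x; ring
    rw [e1, integral_sub i34 i12, integral_sub h3 h4, integral_sub h1 h2]
  rw [eP, eA, eX, T1, T2]
  ring

/-- The Jeffreys integrand integrates to twice the asymmetry information: `∫ (qJ − q)(log qJ − log q) = 2 KL(QJ‖Q)`
(for an involution `KL(QJ‖Q) = KL(Q‖QJ)`). -/
theorem integral_jeffreysIntegrand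
    (hJ : MeasurePreserving J μ μ) (hJJ : Involutive J)
    (h1 : Integrable (fun x => q x * Real.log (q x)) μ)
    (h3 : Integrable (fun x => q (J x) * Real.log (q x)) μ) :
    ∫ x, jeffreysIntegrand J q x ∂μ = 2 * asymmetryInfo μ J q := by
  have hJ2 : ∀ x, J (J x) = x := hJJ
  have hemb : MeasurableEmbedding J :=
    (MeasurableEquiv.ofInvolutive J hJJ hJ.measurable).measurableEmbedding
  have i1 : Integrable (fun x => q (J x) * Real.log (q (J x))) μ :=
    (hJ.integrable_comp_emb hemb (g := fun x => q x * Real.log (q x))).2 h1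
  have i6 : Integrable (fun x => q x * Real.log (q (J x))) μ := by
    have h := (hJ.integrable_comp_emb hemb (g := fun x => q (J x) * Real.log (q x))).2 h3
    refine h.congr (Filter.Eventually.of_forall fun x => ?_)
    simp [Function.comp, hJ2]
  -- `∫ q (log qJ − log q) = −A` by transport
  have T : ∫ x, q x * Real.log (q (J x)) ∂μ = ∫ x, q (J x) * Real.log (q x) ∂μ := by
    have h := hJ.integral_comp hemb (fun x => q (J x) * Real.log (q x))
    simp only [hJ2] at h
    exact h
  have e1 : (fun x => jeffreysIntegrand J q x)
      = fun x => (q (J x) * Real.log (q (J x)) - q (J x) * Real.log (q x))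
          - (q x * Real.log (q (J x)) - q x * Real.log (q x)) := by
    ext x; unfold jeffreysIntegrand; ring
  have hsplit : ∫ x, ((q (J x) * Real.log (q (J x)) - q (J x) * Real.log (q x))
      - (q x * Real.log (q (J x)) - q x * Real.log (q x))) ∂μ
      = ((∫ x, q (J x) * Real.log (q (J x)) ∂μ) - ∫ x, q (J x) * Real.log (q x) ∂μ)
        - ((∫ x, q x * Real.log (q (J x)) ∂μ) - ∫ x, q x * Real.log (q x) ∂μ) := by
    have hA1 : ∫ x, (q (J x) * Real.log (q (J x)) - q (J x) * Real.log (q x)) ∂μ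
        = (∫ x, q (J x) * Real.log (q (J x)) ∂μ) - ∫ x, q (J x) * Real.log (q x) ∂μ :=
      integral_sub i1 h3
    have hA2 : ∫ x, (q x * Real.log (q (J x)) - q x * Real.log (q x)) ∂μ
        = (∫ x, q x * Real.log (q (J x)) ∂μ) - ∫ x, q x * Real.log (q x) ∂μ :=
      integral_sub i6 h1
    have hA3 : ∫ x, ((q (J x) * Real.log (q (J x)) - q (J x) * Real.log (q x))
        - (q x * Real.log (q (J x)) - q x * Real.log (q x))) ∂μ
        = (∫ x, (q (J x) * Real.log (q (J x)) - q (J x) * Real.log (q x)) ∂μ)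
          - ∫ x, (q x * Real.log (q (J x)) - q x * Real.log (q x)) ∂μ :=
      integral_sub (i1.sub h3) (i6.sub h1)
    rw [hA3, hA1, hA2]
  rw [e1, hsplit, T]
  have eA : asymmetryInfo μ J q
      = (∫ x, q (J x) * Real.log (q (J x)) ∂μ) - ∫ x, q (J x) * Real.log (q x) ∂μ := by
    unfold asymmetryInfo
    rw [← integral_sub i1 h3]
    congr 1; ext x; ring
  have T1 : ∫ x, q (J x) * Real.log (q (J x)) ∂μ = ∫ x, q x * Real.log (q x) ∂μ :=
    hJ.integral_comp hemb (fun x => q x * Real.log (q x))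
  rw [eA, T1]
  ring

/-- The odd log-correlation term only sees the J-ODD part of the log pair-correlation:
`∫ (qJ − q) ψ = ∫ (qJ − q) ψ_odd` (the J-even part integrates to zero by transport). -/
theorem oddLogCorrelation_eq_integral_oddPart
    (hJ : MeasurePreserving J μ μ) (hJJ : Involutive J)
    (h1 : Integrable (fun x => q x * Real.log (q x)) μ)
    (h2 : Integrable (fun x => q x * Real.log (b x)) μ)
    (h3 : Integrable (fun x => q (J x) * Real.log (q x)) μ)
    (h4 : Integrable (fun x => q (J x) * Real.log (b x)) μ) :
    oddLogCorrelation μ J q b = ∫ x, (q (J x) - q x) * oddPart J (logCorr q b) x ∂μ := by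
  have hJ2 : ∀ x, J (J x) = x := hJJ
  have hemb : MeasurableEmbedding J :=
    (MeasurableEquiv.ofInvolutive J hJJ hJ.measurable).measurableEmbedding
  -- the full integrand and its transport
  set F : X → ℝ := fun x => (q (J x) - q x) * logCorr q b x with hF
  have iF : Integrable F μ := by
    have : F = fun x => (q (J x) * Real.log (q x) - q (J x) * Real.log (b x))
        - (q x * Real.log (q x) - q x * Real.log (b x)) := by
      ext x; simp only [hF, logCorr]; ring
    rw [this]; exact (h3.sub h4).sub (h1.sub h2)
  have iFJ : Integrable (fun x => F (J x)) μ := (hJ.integrable_comp_emb hemb (g := F)).2 iF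
  have TF : ∫ x, F (J x) ∂μ = ∫ x, F x ∂μ := hJ.integral_comp hemb F
  have hFJ : ∀ x, F (J x) = -((q (J x) - q x) * logCorr q b (J x)) := by
    intro x; simp only [hF, hJ2]; ring
  have key : (fun x => (q (J x) - q x) * oddPart J (logCorr q b) x)
      = fun x => (F x + F (J x)) / 2 := by
    ext x; rw [hFJ]; simp only [hF, oddPart]; ring
  rw [key, integral_div, integral_add iF iFJ, TF]
  unfold oddLogCorrelation
  simp only [hF, logCorr]
  ring

omit [MeasurableSpace X] in
/-- **Gibbs sign, pointwise form**: if `q` and `q ∘ J` are non-negative and vanish together, the Jeffreys integrand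
is non-negative (monotonicity of `log`; the junk `log 0 = 0` only meets `0 · _`). -/
theorem jeffreysIntegrand_nonneg {x : X} (hq : 0 ≤ q x) (hqJ : 0 ≤ q (J x))
    (hzero : q x = 0 ↔ q (J x) = 0) : 0 ≤ jeffreysIntegrand J q x := by
  unfold jeffreysIntegrand
  rcases eq_or_lt_of_le hq with h0 | hpos
  · have hJ0 : q (J x) = 0 := hzero.1 h0.symm
    rw [← h0, hJ0]; simp
  · have hJpos : 0 < q (J x) := by
      rcases eq_or_lt_of_le hqJ with h | h
      · exact absurd (hzero.2 h.symm) hpos.ne'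
      · exact h
    rcases le_total (q x) (q (J x)) with hle | hle
    · exact mul_nonneg (sub_nonneg.2 hle) (sub_nonneg.2 (Real.log_le_log hpos hle))
    · exact mul_nonneg_of_nonpos_of_nonpos (sub_nonpos.2 hle)
        (sub_nonpos.2 (Real.log_le_log hJpos hle))

/-- **The odd log-correlation from POINTWISE one-sided relative odd chaos**: the `μ`-preserving involution, the four
integrabilities and K1 — a.e. `(qJ − q)·ψ_odd ≥ −κ·(Jeffreys integrand)/2 − e` with `e` integrable — give
`oddLogCorrelation ≥ −κ·KL(QJ‖Q) − ∫e`.  (No positivity and no restriction on `κ` needed here.) -/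
theorem oddLogCorrelation_ge_of_pointwise
    (hJ : MeasurePreserving J μ μ) (hJJ : Involutive J)
    (h1 : Integrable (fun x => q x * Real.log (q x)) μ)
    (h2 : Integrable (fun x => q x * Real.log (b x)) μ)
    (h3 : Integrable (fun x => q (J x) * Real.log (q x)) μ)
    (h4 : Integrable (fun x => q (J x) * Real.log (b x)) μ)
    {κ : ℝ} {e : X → ℝ} (he : Integrable e μ)
    (hK1 : ∀ᵐ x ∂μ, -(κ * (jeffreysIntegrand J q x / 2)) - e x ≤
      (q (J x) - q x) * oddPart J (logCorr q b) x) :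
    -(κ * asymmetryInfo μ J q) - ∫ x, e x ∂μ ≤ oddLogCorrelation μ J q b := by
  have hJ2 : ∀ x, J (J x) = x := hJJ
  have hemb : MeasurableEmbedding J :=
    (MeasurableEquiv.ofInvolutive J hJJ hJ.measurable).measurableEmbedding
  -- integrability of the Jeffreys integrand and of the odd-part integrand
  have i1 : Integrable (fun x => q (J x) * Real.log (q (J x))) μ :=
    (hJ.integrable_comp_emb hemb (g := fun x => q x * Real.log (q x))).2 h1
  have i6 : Integrable (fun x => q x * Real.log (q (J x))) μ := by
    have h := (hJ.integrable_comp_emb hemb (g := fun x => q (J x) * Real.log (q x))).2 h3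
    refine h.congr (Filter.Eventually.of_forall fun x => ?_)
    simp [Function.comp, hJ2]
  have iJeff : Integrable (fun x => jeffreysIntegrand J q x) μ := by
    have : (fun x => jeffreysIntegrand J q x)
        = fun x => (q (J x) * Real.log (q (J x)) - q (J x) * Real.log (q x))
            - (q x * Real.log (q (J x)) - q x * Real.log (q x)) := by
      ext x; unfold jeffreysIntegrand; ring
    rw [this]; exact (i1.sub h3).sub (i6.sub h1)
  set F : X → ℝ := fun x => (q (J x) - q x) * logCorr q b x with hF
  have iF : Integrable F μ := by
    have : F = fun x => (q (J x) * Real.log (q x) - q (J x) * Real.log (b x))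
        - (q x * Real.log (q x) - q x * Real.log (b x)) := by
      ext x; simp only [hF, logCorr]; ring
    rw [this]; exact (h3.sub h4).sub (h1.sub h2)
  have iFJ : Integrable (fun x => F (J x)) μ := (hJ.integrable_comp_emb hemb (g := F)).2 iF
  have hFJ : ∀ x, F (J x) = -((q (J x) - q x) * logCorr q b (J x)) := by
    intro x; simp only [hF, hJ2]; ring
  have iOdd : Integrable (fun x => (q (J x) - q x) * oddPart J (logCorr q b) x) μ := by
    have key : (fun x => (q (J x) - q x) * oddPart J (logCorr q b) x)
        = fun x => (F x + F (J x)) / 2 := by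
      ext x; rw [hFJ]; simp only [hF, oddPart]; ring
    rw [key]; exact (iF.add iFJ).div_const 2
  have hJeff := integral_jeffreysIntegrand hJ hJJ h1 h3
  have hX := oddLogCorrelation_eq_integral_oddPart hJ hJJ h1 h2 h3 h4
  rw [hX]
  have hneg : Integrable (fun x => -(κ * (jeffreysIntegrand J q x / 2))) μ :=
    ((iJeff.div_const 2).const_mul κ).neg
  have hint : Integrable (fun x => -(κ * (jeffreysIntegrand J q x / 2)) - e x) μ := hneg.sub he
  have hmono := integral_mono_ae hint iOdd hK1
  have hcalc : ∫ x, (-(κ * (jeffreysIntegrand J q x / 2)) - e x) ∂μ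
      = -(κ * asymmetryInfo μ J q) - ∫ x, e x ∂μ := by
    have hs : ∫ x, (-(κ * (jeffreysIntegrand J q x / 2)) - e x) ∂μ
        = (∫ x, -(κ * (jeffreysIntegrand J q x / 2)) ∂μ) - ∫ x, e x ∂μ := integral_sub hneg he
    have hn : ∫ x, -(κ * (jeffreysIntegrand J q x / 2)) ∂μ = -(∫ x, κ * (jeffreysIntegrand J q x / 2) ∂μ) :=
      integral_neg _
    have hm : ∫ x, κ * (jeffreysIntegrand J q x / 2) ∂μ = κ * ∫ x, jeffreysIntegrand J q x / 2 ∂μ :=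
      integral_const_mul _ _
    have hd : ∫ x, jeffreysIntegrand J q x / 2 ∂μ = (∫ x, jeffreysIntegrand J q x ∂μ) / 2 :=
      integral_div _ _
    rw [hs, hn, hm, hd, hJeff]
    ring
  rw [hcalc] at hmono
  exact hmono

/-- **Gibbs sign for the asymmetry information**: `0 ≤ KL(QJ‖Q)` from the pointwise Gibbs condition (`q`, `q∘J`
non-negative and vanishing together a.e.) — no global positivity `∀ x, 0 < q x` is assumed (TRIAGE r2-3 (e): that hypothesis
of the ideator's lemma fails off the incoming set). -/
theorem asymmetryInfo_nonneg_of_ae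
    (hJ : MeasurePreserving J μ μ) (hJJ : Involutive J)
    (h1 : Integrable (fun x => q x * Real.log (q x)) μ)
    (h3 : Integrable (fun x => q (J x) * Real.log (q x)) μ)
    (hq : ∀ᵐ x ∂μ, 0 ≤ q x ∧ (q x = 0 ↔ q (J x) = 0)) :
    0 ≤ asymmetryInfo μ J q := by
  have hJeff := integral_jeffreysIntegrand hJ hJJ h1 h3
  have hqJ : ∀ᵐ x ∂μ, 0 ≤ q (J x) ∧ (q (J x) = 0 ↔ q (J (J x)) = 0) :=
    hJ.quasiMeasurePreserving.tendsto_ae.eventually hq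
  have hnn : 0 ≤ ∫ x, jeffreysIntegrand J q x ∂μ := by
    refine integral_nonneg_of_ae ?_
    filter_upwards [hq, hqJ] with x hx hxJ
    exact jeffreysIntegrand_nonneg hx.1 hxJ.1 hx.2
  nlinarith [hJeff]

/-- **The sign from POINTWISE one-sided relative odd chaos** (the composition's use of K1): with `κ ≤ 1`,
`bookedProduction ≥ (1 − κ)·KL(QJ‖Q) − ∫e ≥ −∫ e`. -/
theorem bookedProduction_ge_of_pointwise
    (hJ : MeasurePreserving J μ μ) (hJJ : Involutive J)
    (h1 : Integrable (fun x => q x * Real.log (q x)) μ)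
    (h2 : Integrable (fun x => q x * Real.log (b x)) μ)
    (h3 : Integrable (fun x => q (J x) * Real.log (q x)) μ)
    (h4 : Integrable (fun x => q (J x) * Real.log (b x)) μ)
    (hq : ∀ᵐ x ∂μ, 0 ≤ q x ∧ (q x = 0 ↔ q (J x) = 0))
    {κ : ℝ} (hκ : κ ≤ 1) {e : X → ℝ} (he : Integrable e μ)
    (hK1 : ∀ᵐ x ∂μ, -(κ * (jeffreysIntegrand J q x / 2)) - e x ≤
      (q (J x) - q x) * oddPart J (logCorr q b) x) :
    -(∫ x, e x ∂μ) ≤ bookedProduction μ J q b := by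
  have hId := bookedProduction_eq_asymmetryInfo_add_oddLogCorrelation hJ hJJ h1 h2 h3 h4
  have hA := asymmetryInfo_nonneg_of_ae hJ hJJ h1 h3 hq
  have hXge := oddLogCorrelation_ge_of_pointwise hJ hJJ h1 h2 h3 h4 he hK1
  rw [hId]
  nlinarith [hA, hXge, hκ]

/-- **The budget** (K1 read upward — the card's one new implication, conceded by all three triagers): under the same
hypotheses (no positivity, any `κ`), `(1 − κ)·KL(QJ‖Q) ≤ bookedProduction + ∫e`.  Since the booked production is bounded by
the kinetic-entropy drop, an a-priori quantity, this is the Maxwellisation budget feeding stub M. -/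
theorem asymmetryInfo_le_of_pointwise
    (hJ : MeasurePreserving J μ μ) (hJJ : Involutive J)
    (h1 : Integrable (fun x => q x * Real.log (q x)) μ)
    (h2 : Integrable (fun x => q x * Real.log (b x)) μ)
    (h3 : Integrable (fun x => q (J x) * Real.log (q x)) μ)
    (h4 : Integrable (fun x => q (J x) * Real.log (b x)) μ)
    {κ : ℝ} {e : X → ℝ} (he : Integrable e μ)
    (hK1 : ∀ᵐ x ∂μ, -(κ * (jeffreysIntegrand J q x / 2)) - e x ≤
      (q (J x) - q x) * oddPart J (logCorr q b) x) :
    (1 - κ) * asymmetryInfo μ J q ≤ bookedProduction μ J q b + ∫ x, e x ∂μ := by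
  have hId := bookedProduction_eq_asymmetryInfo_add_oddLogCorrelation hJ hJJ h1 h2 h3 h4
  have hXge := oddLogCorrelation_ge_of_pointwise hJ hJJ h1 h2 h3 h4 he hK1
  rw [hId]
  nlinarith [hXge]

end Kernel

/-! ## § Objects — the ensemble (BBGKY-level, trace-free) objects of the line

Everything below is built over the landed pieces of the crux functional (`cone`, `rhoC`, `momC`, `kinC`, `thetaC`, `Hs`,
`entropyFunctional`: `Theorems/LocalSecondLaw/Negative/Functional.lean`, DEFINITIONALLY the crux's `let`-tower), the
ledger vocabulary (`Flow`, `Phase`, `pD`, `tproj`, `vin`: `Theorems/JParityClosureLocalSecondLawLedgerDefs.lean`) and the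
tree's collision kinematics (`collide`, `sphereMeasure`, `collisionTimes`, `sepVec`, `reflectVel`). -/

variable {N : ℕ}

/-- A coarse HISTORY CENTRE: a deterministic candidate for the coarse fields `(ρ_r, m_r, e_r)(s, x)`. -/
abbrev Centre : Type := ℝ → T3 → ℝ × V3 × ℝ

/-- The PINNED CELL of a centre at resolution `η′`: phase points whose coarse history `s ↦ (ρ_r, m_r, e_r)(Φₛz)` stays
within `η′` of the centre in sup-norm on `[0,τ] × 𝕋³`. -/
def Pin (σ r τ η' : ℝ) (Φ : Flow σ N) (c : Centre) : Set (Phase N) :=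
  {z | ∀ s ∈ Set.Icc (0 : ℝ) τ, ∀ x : T3,
      |rhoC r (Φ.flow s z) x - (c s x).1| ≤ η' ∧ ‖momC r (Φ.flow s z) x - (c s x).2.1‖ ≤ η' ∧
        |kinC r (Φ.flow s z) x - (c s x).2.2| ≤ η'}

/-- Pinned cells are monotone in the resolution. -/
theorem Pin_mono {σ r τ η₁ η₂ : ℝ} (h : η₁ ≤ η₂) (Φ : Flow σ N) (c : Centre) :
    Pin σ r τ η₁ Φ c ⊆ Pin σ r τ η₂ Φ c := by
  intro z hz s hs x
  obtain ⟨h1, h2, h3⟩ := hz s hs x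
  exact ⟨h1.trans h, h2.trans h, h3.trans h⟩

/-- The CONDITIONED LAW `μ(· | S) = μ(S)⁻¹ · μ|_S` (a bounded tilt of `μ` when `μ(S)` is bounded below). -/
def condLaw (μ : Measure (Phase N)) (S : Set (Phase N)) : Measure (Phase N) :=
  (μ S)⁻¹ • μ.restrict S

/-- Mean coarse density `ρ̄(s,x) = E_ν[ρ_r(Φₛz)(x)]` of a law `ν`. -/
def rhoBar (r : ℝ) (ν : Measure (Phase N)) {σ : ℝ} (Φ : Flow σ N) (s : ℝ) (x : T3) : ℝ :=
  ∫ z, rhoC r (Φ.flow s z) x ∂ν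

/-- Mean coarse momentum `m̄(s,x) = E_ν[m_r(Φₛz)(x)]`. -/
def momBar (r : ℝ) (ν : Measure (Phase N)) {σ : ℝ} (Φ : Flow σ N) (s : ℝ) (x : T3) : V3 :=
  ∫ z, momC r (Φ.flow s z) x ∂ν

/-- Mean coarse kinetic energy `ē(s,x) = E_ν[e_r(Φₛz)(x)]`. -/
def kinBar (r : ℝ) (ν : Measure (Phase N)) {σ : ℝ} (Φ : Flow σ N) (s : ℝ) (x : T3) : ℝ :=
  ∫ z, kinC r (Φ.flow s z) x ∂ν

/-- Mean coarse temperature `θ̄ = (2/3)(ē/ρ̄ − |m̄|²/(2ρ̄²))` (the crux's formula at the mean fields; junk `0/0 = 0`). -/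
def thetaBar (r : ℝ) (ν : Measure (Phase N)) {σ : ℝ} (Φ : Flow σ N) (s : ℝ) (x : T3) : ℝ :=
  2 / 3 * (kinBar r ν Φ s x / rhoBar r ν Φ s x - ‖momBar r ν Φ s x‖ ^ 2 / (2 * rhoBar r ν Φ s x ^ 2))

/-- Mean coarse velocity `ū = m̄/ρ̄`, componentwise, with the crux's junk convention. -/
def uBar (r : ℝ) (ν : Measure (Phase N)) {σ : ℝ} (Φ : Flow σ N) (s : ℝ) (x : T3) (k : Fin 3) : ℝ :=
  (momBar r ν Φ s x) k / rhoBar r ν Φ s x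

/-- Time part of the ENSEMBLE crux functional: `∫₀^τ ∫ Hs(ρ̄, θ̄) ∂ₛφ dx ds`. -/
def ensT (σ r τ : ℝ) (φ : ℝ → T3 → ℝ) (ν : Measure (Phase N)) (Φ : Flow σ N) : ℝ :=
  ∫ s in Set.Icc (0 : ℝ) τ, ∫ x : T3,
    Hs σ (rhoBar r ν Φ s x) (thetaBar r ν Φ s x) * deriv (fun s' => φ s' x) s

/-- Transport part of the ENSEMBLE crux functional: `∫₀^τ ∫ Hs(ρ̄, θ̄) ū·∇φ dx ds`. -/
def ensX (σ r τ : ℝ) (φ : ℝ → T3 → ℝ) (ν : Measure (Phase N)) (Φ : Flow σ N) : ℝ :=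
  ∫ s in Set.Icc (0 : ℝ) τ, ∫ x : T3,
    Hs σ (rhoBar r ν Φ s x) (thetaBar r ν Φ s x) * ∑ k : Fin 3, uBar r ν Φ s x k * pD k (φ s) x

/-- **The ENSEMBLE crux functional** `𝓘[ν]` — the crux integrand at the MEAN coarse fields of `ν` (time part plus
transport part; a sum of two integrals by definition). -/
def ensFunctional (σ r τ : ℝ) (φ : ℝ → T3 → ℝ) (ν : Measure (Phase N)) (Φ : Flow σ N) : ℝ :=
  ensT σ r τ φ ν Φ + ensX σ r τ φ ν Φ

/-! ### One-particle density, kinetic entropy, the Résibois comparison density -/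

/-- One-particle phase point `ℝ × 𝕋³ × V3` (time, position, velocity). -/
abbrev Pt1 : Type := ℝ × T3 × V3

/-- `f` IS A (slice-wise) ONE-PARTICLE DENSITY of the law `ν` transported by `Φ` on `[0,τ]`: non-negative, jointly
measurable, and for EVERY `s ∈ [0,τ]` the density of the expected empirical one-particle measure at time `s` against
bounded measurable test functions (trace-free duality; a.e.-unique per slice). -/
def IsOneParticleDensity (τ : ℝ) (ν : Measure (Phase N)) {σ : ℝ} (Φ : Flow σ N) (f : Pt1 → ℝ) : Prop :=
  (∀ p, 0 ≤ f p) ∧ Measurable f ∧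
    ∀ s ∈ Set.Icc (0 : ℝ) τ, ∀ G : T3 × V3 → ℝ, Measurable G → (∃ C : ℝ, ∀ y, |G y| ≤ C) →
      Integrable (fun z => (N + 1 : ℝ)⁻¹ * ∑ i : Fin (N + 1), G (Φ.flow s z i)) ν ∧
        ∫ z, ((N + 1 : ℝ)⁻¹ * ∑ i : Fin (N + 1), G (Φ.flow s z i)) ∂ν = ∫ y : T3 × V3, G y * f (s, y)

/-- Kinetic entropy density `h₁(s, y) = ∫ f log f dv`. -/
def h1 (f : Pt1 → ℝ) (s : ℝ) (y : T3) : ℝ :=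
  ∫ v : V3, f (s, y, v) * Real.log (f (s, y, v))

/-- Kinetic entropy flux `j₁(s, y) = ∫ v f log f dv`, componentwise. -/
def j1 (f : Pt1 → ℝ) (s : ℝ) (y : T3) (k : Fin 3) : ℝ :=
  ∫ v : V3, f (s, y, v) * Real.log (f (s, y, v)) * v k

/-- Cone-smeared kinetic entropy `h̄ = b_r ∗ h₁` at the field point `x`. -/
def hBar (r : ℝ) (f : Pt1 → ℝ) (s : ℝ) (x : T3) : ℝ :=
  ∫ y : T3, cone r y x * h1 f s y

/-- Cone-smeared kinetic entropy flux `j̄ = b_r ∗ j₁`, componentwise. -/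
def jBar (r : ℝ) (f : Pt1 → ℝ) (s : ℝ) (x : T3) (k : Fin 3) : ℝ :=
  ∫ y : T3, cone r y x * j1 f s y k

/-- The Maxwellian entropy constant `c₀ = (3/2)(1 + log 2π)`: `∫ M log M = ρ log ρ − (3/2)ρ log θ − c₀ρ`. -/
def c0 : ℝ := 3 / 2 * (1 + Real.log (2 * Real.pi))

/-- The smeared Résibois/RET `H`-density of the law: `h̄_kin = b_r ∗ h₁ + c₀ρ̄ + ρ̄ f_ex(ρ̄σ³)` — the line's comparison
density for `Hs(ρ̄, θ̄)`; `Hs(ρ̄,θ̄) − h̄_kin = −[b_r∗h₁ − h(b_r∗ₓf)] − KL(b_r∗ₓf ‖ M) ≤ 0` on `{ρ̄ > 0}` (Jensen + Gibbs;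
the `f_ex` terms CANCEL). -/
def hKinBar (σ r : ℝ) (f : Pt1 → ℝ) (ν : Measure (Phase N)) (Φ : Flow σ N) (s : ℝ) (x : T3) : ℝ :=
  hBar r f s x + c0 * rhoBar r ν Φ s x +
    rhoBar r ν Φ s x * hsExcessFreeEnergy (rhoBar r ν Φ s x * σ ^ 3)

/-- The smeared Résibois `H`-flux `j̄_kin = b_r ∗ j₁ + (c₀ρ̄ + ρ̄ f_ex(ρ̄σ³)) ū`, componentwise. -/
def jKinBar (σ r : ℝ) (f : Pt1 → ℝ) (ν : Measure (Phase N)) (Φ : Flow σ N) (s : ℝ) (x : T3) (k : Fin 3) : ℝ :=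
  jBar r f s x k +
    (c0 * rhoBar r ν Φ s x + rhoBar r ν Φ s x * hsExcessFreeEnergy (rhoBar r ν Φ s x * σ ^ 3)) * uBar r ν Φ s x k

/-- **The kinetic weak form** `𝒦 = ∫∫ h̄_kin ∂ₛφ + ∫∫ j̄_kin·∇φ + ∫ h̄_kin(0,·)φ(0,·)` (three integrals). -/
def kinWeakForm (σ r τ : ℝ) (φ : ℝ → T3 → ℝ) (f : Pt1 → ℝ) (ν : Measure (Phase N)) (Φ : Flow σ N) : ℝ :=
  (∫ s in Set.Icc (0 : ℝ) τ, ∫ x : T3, hKinBar σ r f ν Φ s x * deriv (fun s' => φ s' x) s) +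
    (∫ s in Set.Icc (0 : ℝ) τ, ∫ x : T3, ∑ k : Fin 3, jKinBar σ r f ν Φ s x k * pD k (φ s) x) +
      ∫ x : T3, hKinBar σ r f ν Φ 0 x * φ 0 x

/-- Maxwellisation gap (time part of `𝓘` minus time part of `𝒦`): `∫∫ (Hs(ρ̄,θ̄) − h̄_kin) ∂ₛφ` morally. -/
def maxwellGapEns (σ r τ : ℝ) (φ : ℝ → T3 → ℝ) (f : Pt1 → ℝ) (ν : Measure (Phase N)) (Φ : Flow σ N) : ℝ :=
  ensT σ r τ φ ν Φ - ∫ s in Set.Icc (0 : ℝ) τ, ∫ x : T3, hKinBar σ r f ν Φ s x * deriv (fun s' => φ s' x) s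

/-- Entropy-flux gap (transport part of `𝓘` minus flux part of `𝒦`): `∫∫ (Hs ū − j̄_kin)·∇φ = ∫∫ [(H_id − h̄)ū − q̄_K]·∇φ`
morally — contains the conductive kinetic entropy flux, i.e. the CUBIC closure. -/
def fluxGapEns (σ r τ : ℝ) (φ : ℝ → T3 → ℝ) (f : Pt1 → ℝ) (ν : Measure (Phase N)) (Φ : Flow σ N) : ℝ :=
  ensX σ r τ φ ν Φ - ∫ s in Set.Icc (0 : ℝ) τ, ∫ x : T3, ∑ k : Fin 3, jKinBar σ r f ν Φ s x k * pD k (φ s) x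

/-- Initial matching gap `∫ Hs(ρ_E, θ_E)φ(0) − ∫ h̄_kin(0,·)φ(0,·)` against comparison data `ρ_E, θ_E` (the Euler datum
at `t = 0` in the composition). -/
def initialGapEns (σ r : ℝ) (φ : ℝ → T3 → ℝ) (f : Pt1 → ℝ) (ν : Measure (Phase N)) (Φ : Flow σ N)
    (ρE θE : T3 → ℝ) : ℝ :=
  (∫ x : T3, Hs σ (ρE x) (θE x) * φ 0 x) - ∫ x : T3, hKinBar σ r f ν Φ 0 x * φ 0 x

/-- **The ensemble ledger** — an identity of real numbers, true by `ring` (every gap is a difference of integrals). -/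
theorem ensFunctional_add_init_eq (σ r τ : ℝ) (φ : ℝ → T3 → ℝ) (f : Pt1 → ℝ) (ν : Measure (Phase N))
    (Φ : Flow σ N) (ρE θE : T3 → ℝ) :
    ensFunctional σ r τ φ ν Φ + ∫ x : T3, Hs σ (ρE x) (θE x) * φ 0 x =
      kinWeakForm σ r τ φ f ν Φ + maxwellGapEns σ r τ φ f ν Φ + fluxGapEns σ r τ φ f ν Φ +
        initialGapEns σ r φ f ν Φ ρE θE := by
  unfold ensFunctional kinWeakForm maxwellGapEns fluxGapEns initialGapEns
  ring

/-! ### The contact bundle, its measure-preserving involution, the contact density -/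

/-- The CONTACT BUNDLE `[0,τ] × 𝕋³ × (V3 × V3) × 𝕊²`: time, position of the particle, (its PRE-collisional velocity, the
partner's PRE-collisional velocity), unit direction from the particle to its partner (partner at `x + εω`). -/
abbrev Bundle : Type := ℝ × T3 × ((V3 × V3) × Metric.sphere (0 : V3) 1)

/-- Reference measure of the bundle on `[0,τ]`: `ds dx dv dw dω`. -/
def bundleMeasure (τ : ℝ) : Measure Bundle :=
  ((volume : Measure ℝ).restrict (Set.Icc 0 τ)).prod
    ((volume : Measure T3).prod (((volume : Measure V3).prod (volume : Measure V3)).prod sphereMeasure))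

/-- **The bundle involution** `R̂(s, x, (v,w), ω) = (s, x, collide ω (v,w), −ω)`: the OUTGOING pair of the collision READ
BACKWARDS as an incoming pair at the same point (the card's `R`; maps incoming configurations to incoming ones). -/
def Rhat (p : Bundle) : Bundle :=
  (p.1, p.2.1, (collide p.2.2.2 p.2.2.1, -p.2.2.2))

/-- `R̂` is an involution (`collide (−ω) = collide ω` and `collide ω ∘ collide ω = id`). -/
theorem Rhat_involutive : Involutive Rhat := by
  intro p
  obtain ⟨s, x, pvw, ω⟩ := p
  simp only [Rhat, collide_neg_dir, Literature.MathematicalPhysics.KineticTheory.collide_collide, neg_neg]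

/-- `R̂` preserves the bundle measure: it is `id × id × (T₂ ∘ T₁)` with the tree's measure-preserving
`T₁ : ((v,w),ω) ↦ ((collide ω (v,w)).swap, ω)` and `T₂ : ((v,w),ω) ↦ ((v,w).swap, −ω)`. -/
theorem measurePreserving_Rhat (τ : ℝ) : MeasurePreserving Rhat (bundleMeasure τ) (bundleMeasure τ) := by
  haveI := isFiniteMeasure_sphereMeasure (E := V3)
  haveI hsf : SFinite (sphereMeasure : Measure (Metric.sphere (0 : V3) 1)) := inferInstance
  have hT : MeasurePreserving
      (fun q : (V3 × V3) × Metric.sphere (0 : V3) 1 => (collide q.2 q.1, -q.2))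
      (((volume : Measure V3).prod (volume : Measure V3)).prod sphereMeasure)
      (((volume : Measure V3).prod (volume : Measure V3)).prod sphereMeasure) := by
    have h := (measurePreserving_swap_negDir (E := V3)).comp (measurePreserving_collideSwap_prod (E := V3))
    have hfun : ((fun q : (V3 × V3) × Metric.sphere (0 : V3) 1 => (q.1.swap, -q.2)) ∘
        fun q => ((collide q.2 q.1).swap, q.2)) =
        (fun q : (V3 × V3) × Metric.sphere (0 : V3) 1 => (collide q.2 q.1, -q.2)) := by
      funext q; simp [Function.comp, Prod.swap_swap]
    rw [hfun] at h
    exact h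
  have hId1 : MeasurePreserving (id : ℝ → ℝ) ((volume : Measure ℝ).restrict (Set.Icc 0 τ))
      ((volume : Measure ℝ).restrict (Set.Icc 0 τ)) := MeasurePreserving.id _
  have hId2 : MeasurePreserving (id : T3 → T3) (volume : Measure T3) (volume : Measure T3) :=
    MeasurePreserving.id _
  have h23 := hId2.prod hT
  have h := hId1.prod h23
  have hR : Rhat = Prod.map id (Prod.map id
      (fun q : (V3 × V3) × Metric.sphere (0 : V3) 1 => (collide q.2 q.1, -q.2))) := by
    funext p; rfl
  rw [hR]
  exact h

/-- A fixed point of the unit sphere (junk direction off genuine contacts). -/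
def defaultDir : Metric.sphere (0 : V3) 1 :=
  ⟨EuclideanSpace.single 0 1, by simp⟩

/-- Unit direction of a vector, as a point of the sphere (junk `defaultDir` unless `‖u‖ = 1`). -/
def dirOf (u : V3) : Metric.sphere (0 : V3) 1 :=
  if h : ‖u‖ = 1 then ⟨u, by simp [h]⟩ else defaultDir

/-- Unit direction FROM particle `i` TO particle `j`: `ε⁻¹ · sepVec xⱼ xᵢ` (so that the partner sits at `xᵢ + εω`). -/
def dirTo (ε : ℝ) (w : Phase N) (i j : Fin (N + 1)) : Metric.sphere (0 : V3) 1 :=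
  dirOf (ε⁻¹ • (Torus.geometry (Fin 3)).sepVec (w j).1 (w i).1)

/-- The bundle point of the ordered contact pair `(i, j)` at time `s`: `(s, xᵢ, (vᵢ⁻, vⱼ⁻), ω_{i→j})` (pre-collisional
velocities read off the post-collisional state by the reflection involution, `vin`). -/
def contactPt (ε : ℝ) (s : ℝ) (w : Phase N) (i j : Fin (N + 1)) : Bundle :=
  (s, (w i).1, (vin w i j, dirTo ε w i j))

/-- The per-particle collision sum `(N+1)⁻¹ ∑_{collision times s ∈ (0,τ]} ∑_{ordered contact pairs (i,j)} F(contact point)`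
(contact test verbatim that of `collSum` / cruxes 2–4; NO factor `ε`: this counts entropy jumps, not a kinetic rate). -/
def pcollSum (σ τ : ℝ) (Φ : Flow σ N) (z : Phase N) (F : Bundle → ℝ) : ℝ :=
  (N + 1 : ℝ)⁻¹ *
    ∑ᶠ (s : ℝ) (_ : s ∈ collisionTimes (Torus.geometry (Fin 3)) (hsDiameter σ N) (fun t => Φ.flow t z) ∩
        Set.Ioc 0 τ),
      ∑ i : Fin (N + 1), ∑ j : Fin (N + 1),
        (if i ≠ j ∧ ‖(Torus.geometry (Fin 3)).sepVec (Φ.flow s z i).1 (Φ.flow s z j).1‖ = hsDiameter σ N then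
          F (contactPt (hsDiameter σ N) s (Φ.flow s z) i j) else 0)

/-- `q` IS A CONTACT DENSITY of the law `ν` on `[0,τ]`: the density, w.r.t. the bundle measure, of the EXPECTED
EMPIRICAL COLLISION MEASURE (ordered pairs, pre-collisional velocities), characterised against bounded measurable test
functions — the flux-weighted incoming contact pair marginal `|g·ω| f₂(s; x, v; x+εω, w)` times the rate normalisation,
with no trace taken. -/
def IsContactDensity (τ : ℝ) (ν : Measure (Phase N)) {σ : ℝ} (Φ : Flow σ N) (q : Bundle → ℝ) : Prop :=
  (∀ p, 0 ≤ q p) ∧ Measurable q ∧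
    ∀ F : Bundle → ℝ, Measurable F → (∃ C : ℝ, ∀ p, |F p| ≤ C) →
      Integrable (fun z => pcollSum σ τ Φ z F) ν ∧
        ∫ z, pcollSum σ τ Φ z F ∂ν = ∫ p, F p * q p ∂(bundleMeasure τ)

/-- Cone-smeared test function `φ̃(s, y) = ∫ b_r(y, x) φ(s, x) dx` (the smearing TRANSPOSED onto `φ`: `φ̃ ≥ 0`, smooth). -/
def phiTilde (r : ℝ) (φ : ℝ → T3 → ℝ) (s : ℝ) (y : T3) : ℝ :=
  ∫ x : T3, cone r y x * φ s x

/-- The reference pair density `b(s, x, (v,w), ω) = f(s, x, v) · f(s, x + εω, w)` (product of one-particle densities at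
the two centres). -/
def bRef (ε : ℝ) (f : Pt1 → ℝ) (p : Bundle) : ℝ :=
  f (p.1, p.2.1, p.2.2.1.1) * f (p.1, p.2.1 + tproj (ε • (p.2.2.2 : V3)), p.2.2.1.2)

/-- The `φ̃`-weighted contact density `q̃ = φ̃(s,x) q` (the weight is `R̂`-invariant, so it rides inside `q`). -/
def qW (r : ℝ) (φ : ℝ → T3 → ℝ) (q : Bundle → ℝ) (p : Bundle) : ℝ :=
  phiTilde r φ p.1 p.2.1 * q p

/-- **`P_R` — half the booked production on the contact bundle**: `½ ∫ φ̃ q (log b − log b∘R̂)`; the exact collision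
term of the smeared first-marginal entropy balance is `P_R` + (Résibois offset + collisional entropy-flux pairing). -/
def prodR (σ r τ : ℝ) (φ : ℝ → T3 → ℝ) (q : Bundle → ℝ) (f : Pt1 → ℝ) (N : ℕ) : ℝ :=
  (1 / 2 : ℝ) * bookedProduction (bundleMeasure τ) Rhat (qW r φ q) (bRef (hsDiameter σ N) f)

/-- Asymmetry information of the weighted contact law, `A = KL(q̃R̂ ‖ q̃) ≥ 0`. -/
def asymR (r τ : ℝ) (φ : ℝ → T3 → ℝ) (q : Bundle → ℝ) : ℝ :=
  asymmetryInfo (bundleMeasure τ) Rhat (qW r φ q)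

/-- ADMISSIBILITY of a pair `(q, f)` for the kernel identity: the four integrabilities on the bundle and the pointwise
Gibbs condition (`q̃`, `q̃∘R̂` vanish together a.e. — true for contact densities, which are positive exactly on the
incoming set, an `R̂`-invariant set). Regularity, not dynamics. -/
def Admissible (σ r τ : ℝ) (φ : ℝ → T3 → ℝ) (q : Bundle → ℝ) (f : Pt1 → ℝ) (N : ℕ) : Prop :=
  Integrable (fun p => qW r φ q p * Real.log (qW r φ q p)) (bundleMeasure τ) ∧
  Integrable (fun p => qW r φ q p * Real.log (bRef (hsDiameter σ N) f p)) (bundleMeasure τ) ∧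
  Integrable (fun p => qW r φ q (Rhat p) * Real.log (qW r φ q p)) (bundleMeasure τ) ∧
  Integrable (fun p => qW r φ q (Rhat p) * Real.log (bRef (hsDiameter σ N) f p)) (bundleMeasure τ) ∧
  (∀ᵐ p ∂(bundleMeasure τ), 0 ≤ qW r φ q p ∧ (qW r φ q p = 0 ↔ qW r φ q (Rhat p) = 0))

/-- **Pointwise one-sided RELATIVE ODD CHAOS at level `κ` with slack `e`** (the typed content of K1): a.e. on the bundle,
the `R̂`-ODD part of the log pair-correlation `ψ = log q̃ − log b` is bounded ON THE HARMFUL SIDE by `κ` times the `R̂`-odd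
part of `log q̃`, in the product form that is insensitive to the near-reversible zero set:
`(q̃R̂ − q̃)·ψ_odd ≥ −κ·½(q̃R̂ − q̃)(log q̃R̂ − log q̃) − e`. -/
def RelOddChaosPtwise (σ r τ : ℝ) (φ : ℝ → T3 → ℝ) (q : Bundle → ℝ) (f : Pt1 → ℝ) (N : ℕ) (κ : ℝ)
    (e : Bundle → ℝ) : Prop :=
  ∀ᵐ p ∂(bundleMeasure τ),
    -(κ * (jeffreysIntegrand Rhat (qW r φ q) p / 2)) - e p ≤
      (qW r φ q (Rhat p) - qW r φ q p) * oddPart Rhat (logCorr (qW r φ q) (bRef (hsDiameter σ N) f)) p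

/-- TIGHTNESS SANITY (`not_localSecondLawGapAt` built in): at an `R̂`-INVARIANT weighted contact law — global or local
equilibrium with or without drift/shear, static (R-even) correlations included — both sides of K1 vanish identically, so K1
holds at every level `κ` with ZERO slack; no positive gap is ever produced. -/
theorem relOddChaosPtwise_of_invariant {σ r τ : ℝ} {φ : ℝ → T3 → ℝ} {q : Bundle → ℝ} {f : Pt1 → ℝ}
    (hinv : ∀ p, qW r φ q (Rhat p) = qW r φ q p) (κ : ℝ) :
    RelOddChaosPtwise σ r τ φ q f N κ (fun _ => 0) := by
  refine ae_of_all _ fun p => ?_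
  simp [jeffreysIntegrand, hinv p]

/-- **The production sign from pointwise relative odd chaos** (instantiation of the kernel on the real contact bundle;
PROVED): admissibility + K1 at level `κ ≤ 1` with slack `∫e ≤ η` give `P_R ≥ −η/2`. -/
theorem prodR_ge_of_relativeOddChaos {σ r τ : ℝ} {φ : ℝ → T3 → ℝ} {q : Bundle → ℝ} {f : Pt1 → ℝ}
    (hAdm : Admissible σ r τ φ q f N) {κ : ℝ} (hκ : κ ≤ 1) {e : Bundle → ℝ}
    (he : Integrable e (bundleMeasure τ)) {η : ℝ} (heη : ∫ p, e p ∂(bundleMeasure τ) ≤ η)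
    (hK1 : RelOddChaosPtwise σ r τ φ q f N κ e) :
    -(η / 2) ≤ prodR σ r τ φ q f N := by
  obtain ⟨i1, i2, i3, i4, hq⟩ := hAdm
  have h := bookedProduction_ge_of_pointwise (measurePreserving_Rhat τ) Rhat_involutive i1 i2 i3 i4 hq hκ he hK1
  unfold prodR
  linarith

/-- **The Maxwellisation budget on the contact bundle** (K1 read upward; PROVED): admissibility + K1 at level `κ` with slack
`∫e ≤ η` give `(1 − κ)·A ≤ 2·P_R + η` — with `κ < 1` uniform in `N` (as K1 is typed) and `P_R` bounded by the kinetic-entropy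
drop, the asymmetry information of the contacts is an `O(1)` quantity while the bundle mass diverges like `τ/Kn`: the input of
stub M's intended derivation. -/
theorem asymR_le_of_relativeOddChaos {σ r τ : ℝ} {φ : ℝ → T3 → ℝ} {q : Bundle → ℝ} {f : Pt1 → ℝ}
    (hAdm : Admissible σ r τ φ q f N) {κ : ℝ} {e : Bundle → ℝ}
    (he : Integrable e (bundleMeasure τ)) {η : ℝ} (heη : ∫ p, e p ∂(bundleMeasure τ) ≤ η)
    (hK1 : RelOddChaosPtwise σ r τ φ q f N κ e) :
    (1 - κ) * asymR r τ φ q ≤ 2 * prodR σ r τ φ q f N + η := by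
  obtain ⟨i1, i2, i3, i4, -⟩ := hAdm
  have h := asymmetryInfo_le_of_pointwise (measurePreserving_Rhat τ) Rhat_involutive i1 i2 i3 i4 he hK1
  unfold prodR asymR
  linarith

/-! ## § Frames of the line -/

/-- The ENSEMBLE FRAME: for all local-Gibbs profiles, `σ < σ₀(profiles)`, the crux's Euler data (used only through its
`t = 0` slice), all flows, horizons and admissible test functions, and every tolerance `η > 0`, there are a pinning
resolution `η′ > 0` and a radius `r₀ > 0` such that for `r < r₀` and every mass floor `δ″ > 0`, eventually in `N`, the
conclusion holds for EVERY set `S` of local-Gibbs mass `≥ δ″` pinned at resolution `η′` (i.e. for every bounded tilt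
`P_N(·|S)`, `dP_N(·|S)/dP_N ≤ 1/δ″`, with pinned coarse histories).  Limit order `N → ∞` at FIXED `r`. -/
def EnsFrame
    (concl : (σ r τ η : ℝ) → (φ : ℝ → T3 → ℝ) → (ρ θ : ℝ → T3 → ℝ) → (N : ℕ) → Flow σ N →
      Measure (Phase N) → Set (Phase N) → Prop) : Prop :=
  ∀ (a₀ θ₀ : T3 → ℝ) (u₀ : T3 → V3), Continuous a₀ → Continuous θ₀ → Continuous u₀ →
    (∀ x, 0 < a₀ x) → (∀ x, 0 < θ₀ x) →
    ∃ σ₀ : ℝ, 0 < σ₀ ∧ ∀ σ : ℝ, 0 < σ → σ < σ₀ →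
      ∀ (T : ℝ) (ρ θ : ℝ → T3 → ℝ) (u : ℝ → T3 → V3), IsHardSphereEulerSolution σ T ρ u θ →
        ∀ Φ : (N : ℕ) → Flow σ N,
          TendstoHydroFieldsAt (fun N => localGibbsLaw σ a₀ u₀ θ₀ N (Φ N)) Φ ρ u θ 0 → 0 < T →
            ∀ τ : ℝ, 0 < τ →
              ∀ φ : ℝ → T3 → ℝ, Literature.Analysis.FunctionSpaces.Torus.IsSmoothSpaceTimeOn Set.univ φ →
                (∀ s x, 0 ≤ φ s x) → (∃ τ' : ℝ, τ' < τ ∧ ∀ s, τ' ≤ s → ∀ x, φ s x = 0) →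
                ∀ η : ℝ, 0 < η →
                  ∃ η' : ℝ, 0 < η' ∧ ∃ r₀ : ℝ, 0 < r₀ ∧ ∀ r : ℝ, 0 < r → r < r₀ →
                    ∀ δ'' : ℝ, 0 < δ'' → ∃ N₀ : ℕ, ∀ N : ℕ, N₀ ≤ N →
                      ∀ S : Set (Phase N), ENNReal.ofReal δ'' ≤ localGibbsLaw σ a₀ u₀ θ₀ N (Φ N) S →
                        ∀ c : Centre, S ⊆ Pin σ r τ η' (Φ N) c →
                          concl σ r τ η φ ρ θ N (Φ N) (localGibbsLaw σ a₀ u₀ θ₀ N (Φ N)) S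

/-- The ensemble frame WITH A CONTRAST LEVEL `κ < 1` FIXED RIGHT AFTER `σ` (so uniform in the Euler data, the flow, `τ`, `φ`, the
tolerances, `r`, `N` and the cell): the shape of K1, whose mechanism is `κ = O(σ³)`. -/
def EnsFrameK
    (concl : (κ σ r τ η : ℝ) → (φ : ℝ → T3 → ℝ) → (ρ θ : ℝ → T3 → ℝ) → (N : ℕ) → Flow σ N →
      Measure (Phase N) → Set (Phase N) → Prop) : Prop :=
  ∀ (a₀ θ₀ : T3 → ℝ) (u₀ : T3 → V3), Continuous a₀ → Continuous θ₀ → Continuous u₀ →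
    (∀ x, 0 < a₀ x) → (∀ x, 0 < θ₀ x) →
    ∃ σ₀ : ℝ, 0 < σ₀ ∧ ∀ σ : ℝ, 0 < σ → σ < σ₀ → ∃ κ : ℝ, κ < 1 ∧
      ∀ (T : ℝ) (ρ θ : ℝ → T3 → ℝ) (u : ℝ → T3 → V3), IsHardSphereEulerSolution σ T ρ u θ →
        ∀ Φ : (N : ℕ) → Flow σ N,
          TendstoHydroFieldsAt (fun N => localGibbsLaw σ a₀ u₀ θ₀ N (Φ N)) Φ ρ u θ 0 → 0 < T →
            ∀ τ : ℝ, 0 < τ →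
              ∀ φ : ℝ → T3 → ℝ, Literature.Analysis.FunctionSpaces.Torus.IsSmoothSpaceTimeOn Set.univ φ →
                (∀ s x, 0 ≤ φ s x) → (∃ τ' : ℝ, τ' < τ ∧ ∀ s, τ' ≤ s → ∀ x, φ s x = 0) →
                ∀ η : ℝ, 0 < η →
                  ∃ η' : ℝ, 0 < η' ∧ ∃ r₀ : ℝ, 0 < r₀ ∧ ∀ r : ℝ, 0 < r → r < r₀ →
                    ∀ δ'' : ℝ, 0 < δ'' → ∃ N₀ : ℕ, ∀ N : ℕ, N₀ ≤ N →
                      ∀ S : Set (Phase N), ENNReal.ofReal δ'' ≤ localGibbsLaw σ a₀ u₀ θ₀ N (Φ N) S →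
                        ∀ c : Centre, S ⊆ Pin σ r τ η' (Φ N) c →
                          concl κ σ r τ η φ ρ θ N (Φ N) (localGibbsLaw σ a₀ u₀ θ₀ N (Φ N)) S

/-! ## § Statements of the seven stubs -/

/-- **T · history net** (tightness of coarse histories at fixed `r`): for `σ < σ₀(profiles)`, every flow, horizon,
resolution `η′`, tolerance `δ′` and radius `r`, there is an `N`-INDEPENDENT net size `M` such that eventually in `N` the
coarse histories `s ↦ (ρ_r, m_r, e_r)(Φₛz)` of all but `δ′` of the local-Gibbs mass lie within `η′` of one of `M`
centres. -/
def Stubs.stub_historyNet : Prop :=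
  ∀ (a₀ θ₀ : T3 → ℝ) (u₀ : T3 → V3), Continuous a₀ → Continuous θ₀ → Continuous u₀ →
    (∀ x, 0 < a₀ x) → (∀ x, 0 < θ₀ x) →
    ∃ σ₀ : ℝ, 0 < σ₀ ∧ ∀ σ : ℝ, 0 < σ → σ < σ₀ →
      ∀ Φ : (N : ℕ) → Flow σ N, ∀ τ : ℝ, 0 < τ → ∀ η' δ' : ℝ, 0 < η' → 0 < δ' → ∀ r : ℝ, 0 < r →
        ∃ M : ℕ, 0 < M ∧ ∃ N₀ : ℕ, ∀ N : ℕ, N₀ ≤ N → ∃ c : Fin M → Centre,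
          localGibbsLaw σ a₀ u₀ θ₀ N (Φ N) {z | ∀ j : Fin M, z ∉ Pin σ r τ η' (Φ N) (c j)} ≤ ENNReal.ofReal δ'

/-- **Q · pinned representation**: on a pinned cell of non-negligible mass, at most HALF the mass has its pathwise crux
functional more than `η` below the ensemble functional of the conditioned law. -/
def Stubs.stub_pinnedRepresentation : Prop :=
  EnsFrame fun σ r τ η φ _ _ _ Φ μ S =>
    2 * μ.restrict S {z | entropyFunctional σ r τ φ Φ z < ensFunctional σ r τ φ (condLaw μ S) Φ - η} ≤ μ S

/-- **S · exchange pairing** (exact smeared entropy balance + Résibois offset ↔ configurational work): the conditioned law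
has an admissible (one-particle density, contact density) pair for which the kinetic weak form exceeds `P_R` up to `η`. -/
def Stubs.stub_exchangePairing : Prop :=
  EnsFrame fun σ r τ η φ _ _ N Φ μ S =>
    ∃ f q, IsOneParticleDensity τ (condLaw μ S) Φ f ∧ IsContactDensity τ (condLaw μ S) Φ q ∧
      Admissible σ r τ φ q f N ∧ -η ≤ kinWeakForm σ r τ φ f (condLaw μ S) Φ - prodR σ r τ φ q f N

/-- **K1 · relative odd chaos** (THE BET): at a contrast level `κ < 1` depending only on the profiles and `σ`, for every
(one-particle density, contact density) pair of the conditioned law, pointwise one-sided relative odd chaos at level `κ` with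
an integrable slack of total mass `≤ η`. -/
def Stubs.stub_relativeOddChaos : Prop :=
  EnsFrameK fun κ σ r τ η φ _ _ N Φ μ S =>
    ∀ f q, IsOneParticleDensity τ (condLaw μ S) Φ f → IsContactDensity τ (condLaw μ S) Φ q →
      ∃ e : Bundle → ℝ, Integrable e (bundleMeasure τ) ∧
        ∫ p, e p ∂(bundleMeasure τ) ≤ η ∧ RelOddChaosPtwise σ r τ φ q f N κ e

/-- **M · Maxwellisation** of the `r`-smeared marginal of pinned tilted laws (time-`L¹`, paired with `∂ₛφ`). -/
def Stubs.stub_maxwellisation : Prop :=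
  EnsFrame fun σ r τ η φ _ _ _ Φ μ S =>
    ∀ f, IsOneParticleDensity τ (condLaw μ S) Φ f → |maxwellGapEns σ r τ φ f (condLaw μ S) Φ| ≤ η

/-- **K4 · entropy-flux closure** (the conductive kinetic entropy flux of pinned tilted laws pairs to `o(1)` with `∇φ`). -/
def Stubs.stub_entropyFluxClosure : Prop :=
  EnsFrame fun σ r τ η φ _ _ _ Φ μ S =>
    ∀ f, IsOneParticleDensity τ (condLaw μ S) Φ f → |fluxGapEns σ r τ φ f (condLaw μ S) Φ| ≤ η

/-- **B′ · initial matching** (conditioning lemma + the `t = 0` LLN: the smeared Résibois density of the CONDITIONED law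
at `s = 0` matches the Euler datum's entropy). -/
def Stubs.stub_initialMatching : Prop :=
  EnsFrame fun σ r τ η φ ρ θ _ Φ μ S =>
    ∀ f, IsOneParticleDensity τ (condLaw μ S) Φ f → |initialGapEns σ r φ f (condLaw μ S) Φ (ρ 0) (θ 0)| ≤ η

/-! ## § The stubs (registered obligations of the line; `sorry` only here) -/

/-- **T · `stub_historyNet`** (M–L, provable; all `τ`; no chaos).  Tightness of the coarse histories under the local Gibbs
law, uniformly in `N` at fixed `r`: `ρ_r ∈ [0, 3/(πr³)]`, `3/(πr⁴)`-Lipschitz in `x` and `(3/(πr⁴))√(2ke)`-Lipschitz in `s`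
(Disproof §(b)); `m_r`, `e_r` are `C(r)·(1+ke)`-Lipschitz in `x` and, in `s`, Lipschitz between collisions with a
collisional variation controlled by the normalised collision activity (momentum/energy transfer across `O(ε)` displacements
smeared by the Lipschitz cone: `(N+1)⁻¹ ∑_coll |∇b_r| ε |Δv|`), so Arzelà–Ascoli nets of `N`-independent size exist on
`{ke ≤ K} ∩ {collision activity ≤ K′}`, events of mass `≥ 1 − δ′` by the Maxwellian energy tails of the local Gibbs law and
the tightness of the normalised collision count (JParity supports CollisionTightness stmt-13085 — PROVED at rung 0,
p88324 — and KineticEnergyTails stmt-13087 for sup-in-`s` energy).  The centres may depend on `N`; only `M` may not.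
Leans on: `rhoC`, `momC`, `kinC`, `cone_le`, `ke`, `ke_flow_eq` (energy conservation), `numCollisions`,
`isProbabilityMeasure_localGibbsLaw`. -/
theorem stub_historyNet : Stubs.stub_historyNet := by
  sorry

/-- **Q · `stub_pinnedRepresentation`** (L–XL; all `τ`; carries the REGULAR-RANGE content every line must pay — flagged).
On `S ⊆ Pin(c)` the pathwise coarse fields are within `η′` of `c`, hence within `2η′` of the mean fields `(ρ̄, m̄, ē)` of
`P_N(·|S)` (means of pinned quantities are pinned), uniformly on `[0,τ] × 𝕋³`; so `|I(z) − 𝓘[P_N(·|S)]| ≤ ω(2η′)·C(φ)`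
wherever the crux integrand `Hs(ρ,θ)(∂ₛφ + (m/ρ)·∇φ)` is uniformly continuous on the range visited.  It is NOT uniformly
continuous near COLD POPULATED balls (`−(3/2)ρ log θ`), near the packing band edge (`f_ex`, bare-`limsup` EOS: continuity
only inside the HsEosLowDensity band `ρσ³ < η₀`, PROVED there, `Theorems.hsEosLowDensity_proof`) — so the stub needs,
for pinned tilted laws at every `τ`: (i) cold populated balls of small `ρ`-weighted space–time measure for most of the mass
(the card's S4 `ColdSpotsInMeasure` ⟸ GlobalClausius, typed `StrategyCensusS2.GlobalClausius`, XL), (ii) the packing cap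
`ρ_rσ³ < η₀` on `supp φ` for most of the mass (the card's K5 `NoJammingBand` — conceded NECESSARY for the honesty of
`∫Hs` on every line, Disproof junk audit; producer PRE-shock DensityCap stmt-13082, none past `T`: census N2/D3), (iii)
vacuum balls are harmless (`Hs → 0`, `Hs·m/ρ ~ ρ^{1/2} log ρ → 0`).  One-sided (only "pathwise not much BELOW ensemble"
is consumed) but the multiplier `∂ₛφ + u·∇φ` has no sign, so two-sided continuity is what is really used.  Why it might
fail: implosion-type focusing at small `σ` tracked by the particles (ImplosionDichotomy) puts mass above the band on a set
of positive space–time measure with probability `↛ 0`.  Leans on: `entropyFunctional`, `Hs`, `Hs_ge`, `cone_nonneg`,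
`integral_cone_eq_one`, `hsExcessFreeEnergy_le`, `StrategyCensus.hsExcessFreeEnergy_eq_zero_of_gt`. -/
theorem stub_pinnedRepresentation : Stubs.stub_pinnedRepresentation := by
  sorry

/-- **S · `stub_exchangePairing`** (XL: the renormalised balance; + L: the Enskog cancellation; all `τ`).  CONTENT.
(1) EXISTENCE/REGULARITY of the ensemble objects of a bounded tilt `ν = P_N(·|S)` (`dν/dP_N ≤ 1/δ″`) transported by the
flow: a jointly measurable slice-wise one-particle density `f` (Doob/kernel `rnDeriv`), the contact density `q` of the
expected empirical collision measure (a.c. on the bundle: collisions of an a.c. law have a.c. statistics; expected collision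
number finite), `∫ f log f`, `q log q`, `q log b` integrable, `q > 0` exactly on the incoming set (`R̂`-invariant) —
`Admissible`.  (2) THE EXACT SMEARED ENTROPY BALANCE `𝒲[b_r∗h₁, b_r∗j₁] = P_true := ∫ φ̃(s,x)[log f(x,v) − log f(x,v⁺)] q`
(expected `φ̃`-weighted surprisal DROP over ordered contact pairs): the expectation under `ν` of the pathwise weak transport
identity (EmpiricalEnskogIdentity stmt-13086, PROVED, `empiricalEnskogIdentity_proof`) with the `ν`-dependent test function
`φ̃(1 + log f)` — formally exact, NO commutator (the cone smearing is transposed onto `φ`: `∫(b_r∗h₁)φ = ∫h₁φ̃`, `b_r`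
symmetric and translation-covariant), the `1`-part vanishing by the weak continuity equation; rigorously a RENORMALISED
entropy balance for the first marginal of the hard-sphere flow (chain rule for `∫ f log f` along mild BBGKY solutions,
`MildBBGKYae.exists_isMildBBGKYSolutionOnGood`, `IsMildBBGKYSolutionOn.eq_sum_bbgkyDuhamelTerm_holds`; weak contact traces à
la GST2013 Part II) — not in print in this form (TRIAGE r2-2 (3), c8 D4: XL, budget it).  `𝒲[c₀ρ̄, c₀m̄] = 0` (weak
continuity of the mean density, exact), so `𝒦 = P_true + 𝒲_C^ens` with `𝒲_C^ens := 𝒲[ρ̄f_ex(ρ̄σ³), ρ̄f_ex ū]`.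
(3) `P_true − P_R = ½∫ q {[φ̃(x+εω) − φ̃(x)][log f(x+εω,w) − log f(x+εω,w⁺)] + φ̃(x)[log f(x−εω,w⁺) − log f(x+εω,w⁺)]}`
(exchange symmetry `q(s,x,(v,w),ω) = q(s,x+εω,(w,v),−ω)` of ordered pairs): the collisional entropy-FLUX pairing (first
bracket, `≈ (ε/2)∫q ω·∇φ̃ [log f(w) − log f(w⁺)]`, zero at uniform local equilibrium by rotation, `O(σ³Kn)` in general) and
the RÉSIBOIS OFFSET (second, `≈ −ε∫qφ̃ ω·∇ₓlog f(x,w⁺)`, at local equilibrium `= −(2π/3)σ³Y ρ̄²φ̃ div ū + O(σ³Kn)` by the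
tensor computation `∫g₊ωₖ(W+gω)ₗMM ∝ δₖₗ`).  (4) CANCELLATION: `𝒲_C^ens = +σ³∫∫φ ρ̄² f_ex′(ρ̄σ³) div ū` weakly (exact continuity
of the mean density) and `Y = (3/2π) f_ex′` — the card's S3 = EvenStressEnskog stmt-13079 (ALL `τ`, by name; its marks
`((w−v)·n̂)₊n̂ₖn̂ₗ` are these) + the landed `enskog_pressure_cancellation` / `passivityCollisional_of_enskog` identity, here
for MEAN fields of a pinned law (pinning Jensen: `E f_ex(ρ_rσ³) = f_ex(ρ̄σ³) + O(η′)` inside the EOS band).  Layers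
contribute `O(σ³)·vol O(Kn) → 0`.  Two-sided in truth; only `≥ −η` is consumed.  Why it might fail: the positional
Enskog hypothesis at fixed `σ` (contact value `Y` of the pair correlation along the flow, CollisionRate stmt-13481's
why-might-fail) — an `O(φ)` dynamic R-EVEN correction to the contact value shifts the offset at Euler-visible order; and the
renormalised balance may hold only as an INEQUALITY (entropy dissipation at grazing/multiple contacts), which has the right
sign here.  Leans on: `collSum`-type bookkeeping (`pcollSum`, `vin`, `reflectVel_eq_collide`, `reflectVel_smul`),
`empiricalEnskogIdentity_proof`, `cone`, `integral_cone_eq_one`, `hsPressure`, `EosBand`, `enskog_pressure_cancellation`. -/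
theorem stub_exchangePairing : Stubs.stub_exchangePairing := by
  sorry

/-- **K1 · `stub_relativeOddChaos` — THE BET** (crux-sized; Boltzmann-hypothesis class; all `τ`; no producer on the board
at `τ ≥ T` — the IPE engine's output ContactChaos stmt-13477 is `K_N`-level and factorisation-type, one factor `Kn` too
coarse to resolve a layer, card §Why (2) / TRIAGE r2-1 §1B).  Typed SIGN-FREE and POINTWISE as TRIAGE r2-1 (sharpen) and
r2-3 (sharpen 1) demand: not the signed scalar `X ≥ −cA − η` but the parity-resolved structural statement behind it — a.e.
on the contact bundle the `R̂`-ODD part of the log pair-correlation `ψ = log q̃ − log b` (`= (log g₂)_odd`: the flux weight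
`|g·ω|`, Enskog's `Y(ρσ³)`, excluded volume, `log φ̃` and EVERY static structure are `R̂`-even and drop out identically) is
bounded on the harmful side by `κ ≤ 1` times the `R̂`-odd part of `log q̃`, product form
`(q̃R̂ − q̃)ψ_odd ≥ −κ·½(q̃R̂ − q̃)(log q̃R̂ − log q̃) − e`, slack `∫e ≤ η` (the slack absorbs the near-reversible zero set
where `(log q)_odd` vanishes but `ψ_odd` need not — by Pinsker/log-sum `∫|q̃R̂ − q̃|·s ≤ √(2·mass·A)·s`, a pointwise
absolute slack `s = o(Kn^{1/2})` costs `o(1)` since the bundle mass is `≍ τ/Kn`: r2-3's `o(√Kn)`).  At `κ = 1` the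
statement is POINTWISE approximate monotonicity of the reference surprisal, `−(q̃R̂ − q̃)(log b)_odd ≥ −e` — far stronger
than, not equivalent to, the integrated sign it implies (`prodR_ge_of_relativeOddChaos`); under chaos `ψ_odd ≡ 0` and K1
holds with `e = 0`; at every `R̂`-invariant contact law (global/local equilibrium, drift, shear, static correlations) both
sides vanish (tightness `not_localSecondLawGapAt` built in).  Mechanism hoped for: `κ = O(σ³)` (R-odd DYNAMIC pair
correlations at contact are ring/recollision events of relative size `O(φ)`·deviation: Lutsko1996, Lutsko2001,
SotoPiaseckiMareschal2001, DorfmanVanbeijeren1977; Enskog = MD dense shock profiles to `φ ≈ 0.2`, Frezzotti1998,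
FrezzottiSgarra1993; incomplete molecular chaos inside dense shock layers measured by SchlampHathorn2007, acq-06851) and the
SDPI/percolation shape "odd shared information ≤ contraction × injected asymmetry" (PolyanskiyWu2017 §5; cruxes 15177/15178,
open).  The quantifier over bounded tilts `dν/dP_N ≤ 1/δ″` (δ″ fixed before `N₀`) is calibrated: planting an
Orban–Bellemans anti-kinetic region (`X < −A`) costs `≍ N·volume` nats (VelocityReversalBarrier respected, TRIAGE r2-2).
Why it might fail: (a) R-odd contact correlations NOT slaved to the local asymmetry — persistent ring memory after local
Maxwellisation, dense transient pockets where `φ_loc` is not small — give `|X| ≍ A` with the wrong sign in a layer;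
(b) residual macroscopic randomness below the pinning resolution makes the conditioned contact law a MIXTURE, for which
`ψ_odd` carries fake odd correlation (`X = −A` for a mixture of chaotic laws) — the MesoQuiescence doubt (TRIAGE r2-2 (b),
r2-3 (d)), shared with M; (c) the pointwise form may fail on a set the slack cannot pay for even when the integrated form
holds.  Cheapest falsifiers: card (iv) (Enskog + ring linear response under uniform shear: size AND `R̂`-parity of
`(log g₂)_odd`; a `φ⁻¹` or `Kn⁻¹` coefficient kills the bulk half) — pen and paper, run it first; card (iii) (event-driven
MD, `φ = 0.1` shock layer: `X` vs `A`). -/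
theorem stub_relativeOddChaos : Stubs.stub_relativeOddChaos := by
  sorry

/-- **M · `stub_maxwellisation`** (XL; all `τ`; local-equilibrium class — the recorded-dead S3 `MaxwellisationGapVanishes`
of `Lines/kinetic-supersolution-kn-budget-dead.md` moved to the ENSEMBLE marginal of pinned tilted laws, where the card
DERIVES it instead of positing it).  `maxwellGapEns = ∫∫(Hs(ρ̄,θ̄) − h̄_kin)∂ₛφ` and on `{ρ̄ > 0}` (guard off: an a.c. law
has `θ̄ > 0`) `Hs(ρ̄,θ̄) − h̄_kin = −[b_r∗h₁ − h(f̄)] − KL(f̄ ‖ M_{f̄})`, `f̄ := b_r ∗ₓ f` (Jensen for `t log t` under the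
probability kernel `b_r(·,x)`, `integral_cone_eq_one`; Gibbs at the moments `(ρ̄, m̄, ē + 0)` of `f̄`, `∫M log M = ρ log ρ −
(3/2)ρ log θ − c₀ρ`); the `f_ex` terms CANCEL (same argument `ρ̄`) — no EOS input.  So the stub is two-sided smallness in
`|∂ₛφ|`-weighted space–time `L¹` of (i) the JENSEN DEFECT (sub-`r` inhomogeneity of the ensemble marginal: `O(r)` from
layers of width `Kn ≪ r`, `O(r²|∇λ|²)` elsewhere — absorbed by `r₀(η)`) and (ii) `KL(f̄‖M_f̄)`: time-`L¹` MAXWELLISATION of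
the `r`-smeared one-particle marginal of `P_N(·|S)`.  INTENDED DERIVATION (card §Why (3), the one new implication all three
triagers concede; foreseen layer-2 split `Budget → AsymmetryCoercivity → EnsembleChaos → M`): (a) BUDGET — K1 read upward:
`(1−κ)∫∫A ≤ P_R + η` (`asymmetryInfo_le`-type corollary of the kernel) and `P_R ≤ 𝒦 + η ≤ C(data)` with `φ` a pure time
cut-off (`h̄_kin(0)` bounded by the data, `−h̄_kin(τ′) ≤ C(energy)` by the Gibbs lower bound), so `∫₀^τ∫ A = O(1)` while the
bundle mass is `≍ τ/Kn → ∞`: production PER CONTACT must vanish; (b) COERCIVITY K2 `AsymmetryCoercivity` (N-free analysis,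
essentially in print: for flux-weighted chaotic incoming laws `m = f⊗f|g·ω|1_I/Z`, `KL(mR̂‖m) = D(f)/Z ≥ K(f)·H(f|M^f)^{1+ε}`
— VillaniCercignani2003 = RezakhanlouVillani2008 Ch. 1 Thm 4 / ToscaniVillani1999 re-normalised to the half-space flux
weight, constants through moments, smoothness and lower bounds of `f`, hence the `ϑ`-smoothing and max-speed `√log N`
dependence TRIAGE r1-2/r1-3 flagged); (c) ENSEMBLE CHAOS identifying `A` with `D(f)/Z` up to `o(1)` in `O(1)`-weighted
space–time `L¹` (layers excused by measure): ContactChaos stmt-13477 (ALL `τ`, Euler precision suffices HERE) transferred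
from EMPIRICAL to pinned-ENSEMBLE contact laws — the MesoQuiescence input (no macroscopic randomness below the pinning
resolution; TRIAGE r2-2 (b), r2-3 (d): a mixture of chaotic laws has `A = 0` with `f̄` far from Maxwellian), NAMED here as
the place it is load-bearing; (d) RateFloor stmt-13080 (ALL `τ`) converting `∫ZA`-control into `∫ρ̄²√θ̄ K H^{1+ε} ≤ C·Kn → 0`;
cold populated balls as in Q.  Why it might fail: (c) — spontaneous stochasticity past `T` leaves macroscopic randomness at
every fixed pinning resolution (then `P_N(·|S)`'s marginal is a genuine mixture and `KL(f̄‖M) ↛ 0` although every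
realisation Maxwellises); `K(f)` of (b) degrading faster than logarithmically in the local max speed.  Leans on:
`entropyProduction`, `entropyProduction_nonneg`, `integral_collisionOpWith_mul_const_add_log_eq` (H-theorem identity),
`hardSphereLinearizedOp_spectralGap_holds` (near `M`), `localMaxwellian`, `integral_cone_eq_one`, ContactChaos, RateFloor. -/
theorem stub_maxwellisation : Stubs.stub_maxwellisation := by
  sorry

/-- **K4 · `stub_entropyFluxClosure`** (XL; all `τ`; HighMomentumCutoff class — the weak CUBIC closure the crux itself
implies, exact-ledger's `c/V³` witness: NECESSARY for the typed decl on every line, c1 Finding 2 / c8 D2).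
`fluxGapEns = ∫∫ ∑ₖ(Hs(ρ̄,θ̄)ūₖ − j̄_kin,k)∂ₖφ = ∫∫[(H_id(ρ̄,θ̄) − h̄)ū − (j̄ − h̄ū)]·∇φ`: Maxwellisation in `|ū|`-weight (as M)
PLUS the conductive kinetic entropy flux `q̄_K = b_r ∗ ∫(v − u)f log f dv = −q̄_r/θ + ∫(v−u) f log(f/M)`, `q_r` the HEAT FLUX
(third peculiar moment) of the ensemble marginal: its `∇φ`-pairing must vanish — uniform integrability of `|v|³` along the
flow in expectation (EnergyCurrentTails stmt-9235, cubic, PRE-shock, unproved; KineticEnergyTails stmt-13087 is quadratic and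
insufficient) + local equilibrium (`q = O(Kn)` in smooth regions, layers of volume `O(Kn)`).  For bounded tilts the
expectation is `≤ δ″⁻¹×` the local-Gibbs one, so only the UN-conditioned cubic UI is needed.  Why it might fail: no
exponential cubic moment under the invariant law (`HighMomentumCutoffNarrow.setLIntegral_exp_cubic_eq_top`: the `e^{CN}`
entropy transfer is void), and an `N`-independent energy plateau below every `r` past `T` (backscatter, c1 Finding 2(b)).
Leans on: `j1`, `jBar`, `uBar`, KineticEnergyTails, EnergyCurrentTails, `Literature.Barriers.AtomisticToContinuum.HighMomentumCutoffBarrierNarrow`. -/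
theorem stub_entropyFluxClosure : Stubs.stub_entropyFluxClosure := by
  sorry

/-- **B′ · `stub_initialMatching`** (M–L, provable with work; the ONLY consumer of the `t = 0` LLN —
`localSecondLaw_false_without_lln` honoured here).  `|∫Hs(ρ(0),θ(0))φ(0) − ∫h̄_kin(0,·)φ(0)|≤ η` for the CONDITIONED law at
`s = 0`: (i) CONDITIONING LEMMA — `H(P_N(·|S) | P_N) = log(1/P_N(S)) ≤ log(1/δ″) = O(1)` nats, so the time-0 one-particle
marginal of `P_N(·|S)` converges to the same limit as that of `P_N` (velocities: product Maxwellians given positions,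
Csiszár/subadditivity at cost `O(1/N)` per particle; positions: the coarse density cannot deviate on events of fixed mass by
the statics LLN / large deviations; entropy `∫f log f` controlled from above by the Gibbs variational bound and from below
by weak lsc — the card's S5, label-group's ConditioningLemma (C)); (ii) the local-Gibbs one-particle entropy at fixed
`(r)`: `b_r∗h₁(0) + c₀ρ̄ + ρ̄f_ex(ρ̄σ³) → ρ₀ log ρ₀ − (3/2)ρ₀ log θ₀ + ρ₀ f_ex(ρ₀σ³) = Hs(ρ₀,θ₀)` in `L¹(dx)` as `N → ∞` then
`r → 0` (exact Maxwellian velocities, statics LLN `localGibbs_lln_holds`, `integral_cone_eq_one`, CONTINUITY of `f_ex` in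
the band — HsEosLowDensity PROVED, whence the stub's own `σ₀(profiles)`); (iii) `(ρ₀, θ₀-profile) = (ρ(0,·), θ(0,·))` by
`TendstoHydroFieldsAt … 0` (the landed empirical twin is the ledger's B `stub_initialLayer`, InitialLayer.lean p92981).
Why it might fail: only through (i) for pathological `S` — but `S` enters only through its mass floor.  Leans on:
`stub_initialLayer` (landed), `localGibbs_lln_holds`, `isProbabilityMeasure_localGibbsLaw`, `Hs`, `EosBand`,
`Theorems.hsEosLowDensity_proof`. -/
theorem stub_initialMatching : Stubs.stub_initialMatching := by
  sorry

/-! ## § Composition: the seven stubs imply the crux BY NAME (kernel-checked; no `sorry` from here on) -/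

section Composition

/-- ENNReal pigeonhole: if a set of measure `> δ` is covered by an exceptional set of measure `≤ δ/2` and `M ≥ 1` cells,
one cell meets it in measure `≥ δ/(2M)`. -/
theorem exists_cell_of_measure_gt {α : Type*} [MeasurableSpace α] (μ : Measure α) {M : ℕ} (hM : 0 < M)
    (B U : Set α) (P : Fin M → Set α) {δ : ℝ} (hδ : 0 < δ)
    (hcover : B ⊆ U ∪ ⋃ j, (B ∩ P j)) (hU : μ U ≤ ENNReal.ofReal (δ / 2))
    (hB : ¬ μ B ≤ ENNReal.ofReal δ) :
    ∃ j : Fin M, ENNReal.ofReal (δ / (2 * M)) ≤ μ (B ∩ P j) := by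
  by_contra hcon
  push Not at hcon
  apply hB
  have hsum : ∑ j : Fin M, μ (B ∩ P j) ≤ ∑ _j : Fin M, ENNReal.ofReal (δ / (2 * M)) :=
    Finset.sum_le_sum fun j _ => (hcon j).le
  have hM' : (0 : ℝ) < M := by exact_mod_cast hM
  have hconst : ∑ _j : Fin M, ENNReal.ofReal (δ / (2 * M)) = ENNReal.ofReal (δ / 2) := by
    rw [Finset.sum_const, Finset.card_univ, Fintype.card_fin, ← ENNReal.ofReal_nsmul]
    congr 1
    rw [nsmul_eq_mul]
    field_simp
  calc μ B ≤ μ (U ∪ ⋃ j, (B ∩ P j)) := measure_mono hcover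
    _ ≤ μ U + μ (⋃ j, (B ∩ P j)) := measure_union_le _ _
    _ ≤ μ U + ∑ j : Fin M, μ (B ∩ P j) := add_le_add le_rfl (measure_iUnion_fintype_le μ _)
    _ ≤ ENNReal.ofReal (δ / 2) + ENNReal.ofReal (δ / 2) := add_le_add hU (hsum.trans hconst.le)
    _ = ENNReal.ofReal δ := by
        rw [← ENNReal.ofReal_add (by positivity) (by positivity)]; congr 1; ring

/-- The covering used by the pigeonhole: `B ⊆ {∀ j, ∉ P j} ∪ ⋃ⱼ (B ∩ P j)`. -/
theorem subset_exceptional_union {α : Type*} {M : ℕ} (B : Set α) (P : Fin M → Set α) :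
    B ⊆ {z | ∀ j : Fin M, z ∉ P j} ∪ ⋃ j, (B ∩ P j) := by
  intro z hz
  by_cases h : ∃ j : Fin M, z ∈ P j
  · obtain ⟨j, hj⟩ := h
    exact Or.inr (Set.mem_iUnion.2 ⟨j, hz, hj⟩)
  · push Not at h
    exact Or.inl h

/-- If the whole of `S` lies in an event that carries at most half of `S`, then `S` is null (finite measures). -/
theorem measure_eq_zero_of_two_mul_le {α : Type*} [MeasurableSpace α] (μ : Measure α) [IsFiniteMeasure μ]
    (S E : Set α) (hSE : S ⊆ E) (h2 : 2 * μ.restrict S E ≤ μ S) : μ S = 0 := by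
  have hS : μ.restrict S S ≤ μ.restrict S E := measure_mono hSE
  rw [Measure.restrict_apply_self] at hS
  have hfin : μ S ≠ ∞ := measure_ne_top μ S
  have h2' : 2 * μ S ≤ μ S := le_trans (by gcongr) h2
  have h3 : μ S + μ S ≤ μ S + 0 := by rw [add_zero, ← two_mul]; exact h2'
  have h4 : μ S ≤ 0 := (ENNReal.add_le_add_iff_left hfin).1 h3
  exact nonpos_iff_eq_zero.1 h4

/-- **The crux from the stubs** (kernel-checked; concludes `InformationPercolationEngine.LocalSecondLaw` BY NAME; the
JParityClosure copy is the same proposition, `Iff.rfl`).  Order of choices: `σ₀ := min` of the seven thresholds and `1/2`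
(probability normalisation of the local Gibbs law); given the crux's data and `(η, δ)`: each ensemble stub is invoked at
tolerance `η/6`, `η′ := min` of the six resolutions, `r₀ := min` of the six radii; given `r < r₀`: the net T at
`(η′, δ/2, r)` yields `M` and `N₀ᵀ`; the six ensemble stubs at mass floor `δ″ := δ/(2M)` yield `N₀⁽ᵏ⁾`; `N₀ := max`.  For
`N ≥ N₀` suppose `P_N(Bad) > δ`: pigeonhole gives a cell `S = Bad ∩ Pin_j` of mass `≥ δ″`, pinned; S/K1 give `P_R ≥ −η/6`
(`prodR_ge_of_relativeOddChaos`), `𝒦 − P_R ≥ −η/6`, M/K4/B′ give the three gaps `≥ −η/6`, the ensemble ledger gives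
`𝓘 + init_E ≥ −5η/6`, so `Bad ⊆ {I < 𝓘 − η/6}` and Q forces `P_N(S) = 0` — contradiction. -/
theorem LocalSecondLaw_of (hT : Stubs.stub_historyNet) (hQ : Stubs.stub_pinnedRepresentation)
    (hS : Stubs.stub_exchangePairing) (hK1 : Stubs.stub_relativeOddChaos) (hM : Stubs.stub_maxwellisation)
    (hK4 : Stubs.stub_entropyFluxClosure) (hB : Stubs.stub_initialMatching) :
    InformationPercolationEngine.LocalSecondLaw := by
  intro a₀ θ₀ u₀ ha hθ hu ha0 hθ0
  obtain ⟨σT, hσT, HT⟩ := hT a₀ θ₀ u₀ ha hθ hu ha0 hθ0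
  obtain ⟨σQ, hσQ, HQ⟩ := hQ a₀ θ₀ u₀ ha hθ hu ha0 hθ0
  obtain ⟨σS, hσS, HS⟩ := hS a₀ θ₀ u₀ ha hθ hu ha0 hθ0
  obtain ⟨σK, hσK, HK⟩ := hK1 a₀ θ₀ u₀ ha hθ hu ha0 hθ0
  obtain ⟨σM, hσM, HM⟩ := hM a₀ θ₀ u₀ ha hθ hu ha0 hθ0
  obtain ⟨σF, hσF, HF⟩ := hK4 a₀ θ₀ u₀ ha hθ hu ha0 hθ0
  obtain ⟨σB, hσB, HB⟩ := hB a₀ θ₀ u₀ ha hθ hu ha0 hθ0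
  refine ⟨min (min (min σT σQ) (min σS σK)) (min (min σM σF) (min σB (1 / 2))), by positivity, ?_⟩
  intro σ hσ hσlt T ρ θ u hE Φ hLLN hTpos τ hτ φ hφ hφ0 hsupp η δ hη hδ
  have hσT' : σ < σT := hσlt.trans_le (le_trans (min_le_left _ _) (le_trans (min_le_left _ _) (min_le_left _ _)))
  have hσQ' : σ < σQ := hσlt.trans_le (le_trans (min_le_left _ _) (le_trans (min_le_left _ _) (min_le_right _ _)))
  have hσS' : σ < σS := hσlt.trans_le (le_trans (min_le_left _ _) (le_trans (min_le_right _ _) (min_le_left _ _)))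
  have hσK' : σ < σK := hσlt.trans_le (le_trans (min_le_left _ _) (le_trans (min_le_right _ _) (min_le_right _ _)))
  have hσM' : σ < σM := hσlt.trans_le (le_trans (min_le_right _ _) (le_trans (min_le_left _ _) (min_le_left _ _)))
  have hσF' : σ < σF := hσlt.trans_le (le_trans (min_le_right _ _) (le_trans (min_le_left _ _) (min_le_right _ _)))
  have hσB' : σ < σB := hσlt.trans_le (le_trans (min_le_right _ _) (le_trans (min_le_right _ _) (min_le_left _ _)))
  have hσhalf : σ ≤ 1 / 2 :=
    (hσlt.trans_le (le_trans (min_le_right _ _) (le_trans (min_le_right _ _) (min_le_right _ _)))).le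
  have hη6 : 0 < η / 6 := by positivity
  -- the six ensemble stubs at tolerance η/6
  obtain ⟨ηQ, hηQ, rQ, hrQ, HQ'⟩ := HQ σ hσ hσQ' T ρ θ u hE Φ hLLN hTpos τ hτ φ hφ hφ0 hsupp (η / 6) hη6
  obtain ⟨ηS, hηS, rS, hrS, HS'⟩ := HS σ hσ hσS' T ρ θ u hE Φ hLLN hTpos τ hτ φ hφ hφ0 hsupp (η / 6) hη6
  obtain ⟨κ, hκ1, HKκ⟩ := HK σ hσ hσK'
  have hκ : κ ≤ 1 := hκ1.le
  obtain ⟨ηK, hηK, rK, hrK, HK'⟩ := HKκ T ρ θ u hE Φ hLLN hTpos τ hτ φ hφ hφ0 hsupp (η / 6) hη6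
  obtain ⟨ηM, hηM, rM, hrM, HM'⟩ := HM σ hσ hσM' T ρ θ u hE Φ hLLN hTpos τ hτ φ hφ hφ0 hsupp (η / 6) hη6
  obtain ⟨ηF, hηF, rF, hrF, HF'⟩ := HF σ hσ hσF' T ρ θ u hE Φ hLLN hTpos τ hτ φ hφ hφ0 hsupp (η / 6) hη6
  obtain ⟨ηB, hηB, rB, hrB, HB'⟩ := HB σ hσ hσB' T ρ θ u hE Φ hLLN hTpos τ hτ φ hφ hφ0 hsupp (η / 6) hη6
  -- the common pinning resolution and radius
  set η' : ℝ := min (min ηQ (min ηS ηK)) (min ηM (min ηF ηB)) with hη'def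
  have hη'pos : 0 < η' := by positivity
  have hη'Q : η' ≤ ηQ := le_trans (min_le_left _ _) (min_le_left _ _)
  have hη'S : η' ≤ ηS := le_trans (min_le_left _ _) (le_trans (min_le_right _ _) (min_le_left _ _))
  have hη'K : η' ≤ ηK := le_trans (min_le_left _ _) (le_trans (min_le_right _ _) (min_le_right _ _))
  have hη'M : η' ≤ ηM := le_trans (min_le_right _ _) (min_le_left _ _)
  have hη'F : η' ≤ ηF := le_trans (min_le_right _ _) (le_trans (min_le_right _ _) (min_le_left _ _))
  have hη'B : η' ≤ ηB := le_trans (min_le_right _ _) (le_trans (min_le_right _ _) (min_le_right _ _))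
  refine ⟨min (min rQ (min rS rK)) (min rM (min rF rB)), by positivity, ?_⟩
  intro r hr hrlt
  have hrQ' : r < rQ := hrlt.trans_le (le_trans (min_le_left _ _) (min_le_left _ _))
  have hrS' : r < rS := hrlt.trans_le (le_trans (min_le_left _ _) (le_trans (min_le_right _ _) (min_le_left _ _)))
  have hrK' : r < rK := hrlt.trans_le (le_trans (min_le_left _ _) (le_trans (min_le_right _ _) (min_le_right _ _)))
  have hrM' : r < rM := hrlt.trans_le (le_trans (min_le_right _ _) (min_le_left _ _))
  have hrF' : r < rF := hrlt.trans_le (le_trans (min_le_right _ _) (le_trans (min_le_right _ _) (min_le_left _ _)))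
  have hrB' : r < rB := hrlt.trans_le (le_trans (min_le_right _ _) (le_trans (min_le_right _ _) (min_le_right _ _)))
  -- the net at (η', δ/2, r)
  have hδ2 : 0 < δ / 2 := by positivity
  obtain ⟨M, hMpos, NT, HT'⟩ := HT σ hσ hσT' Φ τ hτ η' (δ / 2) hη'pos hδ2 r hr
  -- the mass floor of a pigeonholed cell
  set δ'' : ℝ := δ / (2 * M) with hδ''def
  have hMreal : (0 : ℝ) < M := by exact_mod_cast hMpos
  have hδ'' : 0 < δ'' := by positivity
  obtain ⟨NQ, HQ''⟩ := HQ' r hr hrQ' δ'' hδ''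
  obtain ⟨NS, HS''⟩ := HS' r hr hrS' δ'' hδ''
  obtain ⟨NK, HK''⟩ := HK' r hr hrK' δ'' hδ''
  obtain ⟨NM, HM''⟩ := HM' r hr hrM' δ'' hδ''
  obtain ⟨NF, HF''⟩ := HF' r hr hrF' δ'' hδ''
  obtain ⟨NB, HB''⟩ := HB' r hr hrB' δ'' hδ''
  refine ⟨max (max NT (max NQ NS)) (max (max NK NM) (max NF NB)), fun N hN => ?_⟩
  have hNT : NT ≤ N := le_trans (le_trans (le_max_left _ _) (le_max_left _ _)) hN
  have hNQ : NQ ≤ N := le_trans (le_trans (le_trans (le_max_left _ _) (le_max_right _ _)) (le_max_left _ _)) hN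
  have hNS : NS ≤ N := le_trans (le_trans (le_trans (le_max_right _ _) (le_max_right _ _)) (le_max_left _ _)) hN
  have hNK : NK ≤ N := le_trans (le_trans (le_trans (le_max_left _ _) (le_max_left _ _)) (le_max_right _ _)) hN
  have hNM : NM ≤ N := le_trans (le_trans (le_trans (le_max_right _ _) (le_max_left _ _)) (le_max_right _ _)) hN
  have hNF : NF ≤ N := le_trans (le_trans (le_trans (le_max_left _ _) (le_max_right _ _)) (le_max_right _ _)) hN
  have hNB : NB ≤ N := le_trans (le_trans (le_trans (le_max_right _ _) (le_max_right _ _)) (le_max_right _ _)) hN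
  -- abbreviations
  set μ : Measure (Phase N) := localGibbsLaw σ a₀ u₀ θ₀ N (Φ N) with hμdef
  haveI : IsProbabilityMeasure μ := isProbabilityMeasure_localGibbsLaw ha hθ hu ha0 hθ0 hσhalf N (Φ N)
  set initE : ℝ := ∫ x : T3, Hs σ (ρ 0 x) (θ 0 x) * φ 0 x with hinitE
  set Bad : Set (Phase N) := {z | entropyFunctional σ r τ φ (Φ N) z + initE < -η} with hBad
  -- rewrite the crux event through the landed functional (definitional)
  change μ Bad ≤ ENNReal.ofReal δ
  by_contra hcon
  -- the net and the pigeonhole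
  obtain ⟨c, hc⟩ := HT' N hNT
  obtain ⟨j, hj⟩ := exists_cell_of_measure_gt μ hMpos Bad {z | ∀ j : Fin M, z ∉ Pin σ r τ η' (Φ N) (c j)}
    (fun j => Pin σ r τ η' (Φ N) (c j)) hδ (subset_exceptional_union Bad _) hc hcon
  set S : Set (Phase N) := Bad ∩ Pin σ r τ η' (Φ N) (c j) with hSdef
  have hSmass : ENNReal.ofReal δ'' ≤ μ S := by rw [hδ''def]; exact hj
  have hSpin : ∀ {η₂ : ℝ}, η' ≤ η₂ → S ⊆ Pin σ r τ η₂ (Φ N) (c j) :=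
    fun h => (Set.inter_subset_right).trans (Pin_mono h (Φ N) (c j))
  -- the six ensemble stubs on the cell S
  have EQ := HQ'' N hNQ S hSmass (c j) (hSpin hη'Q)
  have ES := HS'' N hNS S hSmass (c j) (hSpin hη'S)
  have EK := HK'' N hNK S hSmass (c j) (hSpin hη'K)
  have EM := HM'' N hNM S hSmass (c j) (hSpin hη'M)
  have EF := HF'' N hNF S hSmass (c j) (hSpin hη'F)
  have EB := HB'' N hNB S hSmass (c j) (hSpin hη'B)
  -- unpack S (densities, admissibility, exchange pairing) and K1 on them
  obtain ⟨f, q, hf, hq, hAdm, hXi⟩ := ES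
  obtain ⟨e, he, heη, hK1ptw⟩ := EK f q hf hq
  have hP : -((η / 6) / 2) ≤ prodR σ r τ φ q f N := prodR_ge_of_relativeOddChaos hAdm hκ he heη hK1ptw
  have hMg := EM f hf
  have hFg := EF f hf
  have hBg := EB f hf
  -- the ensemble ledger and the lower bound on the ensemble functional
  have hLedger := ensFunctional_add_init_eq σ r τ φ f (condLaw μ S) (Φ N) (ρ 0) (θ 0)
  have hEns : -η + η / 6 ≤ ensFunctional σ r τ φ (condLaw μ S) (Φ N) + initE := by
    rw [hinitE, hLedger]
    have h1 := (abs_le.1 hMg).1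
    have h2 := (abs_le.1 hFg).1
    have h3 := (abs_le.1 hBg).1
    linarith
  -- Bad ⊆ {pathwise < ensemble − η/6}
  have hBadSub : S ⊆ {z | entropyFunctional σ r τ φ (Φ N) z <
      ensFunctional σ r τ φ (condLaw μ S) (Φ N) - η / 6} := by
    intro z hz
    have hzB : z ∈ Bad := hz.1
    simp only [hBad, Set.mem_setOf_eq] at hzB
    simp only [Set.mem_setOf_eq]
    linarith
  -- Q: at most half of S is that far below; hence S is null — contradicting its mass floor
  have hnull : μ S = 0 := measure_eq_zero_of_two_mul_le μ S _ hBadSub EQ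
  rw [hnull] at hSmass
  have : ENNReal.ofReal δ'' = 0 := nonpos_iff_eq_zero.1 hSmass
  rw [ENNReal.ofReal_eq_zero] at this
  linarith

/-- **Closed form for the skeleton register**: the crux (JParityClosure copy — the shared item's primary decl; the
InformationPercolationEngine copy is the same proposition by `Iff.rfl`, so the term of `LocalSecondLaw_of` is accepted
verbatim) from the seven registered stubs.  NOT a proof of the item: its axiom closure contains `sorryAx` through exactly
the seven `stub_*`. -/
theorem LocalSecondLaw_proof : JParityClosure.LocalSecondLaw :=
  LocalSecondLaw_of stub_historyNet stub_pinnedRepresentation stub_exchangePairing stub_relativeOddChaos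
    stub_maxwellisation stub_entropyFluxClosure stub_initialMatching

/-- The same closed form with the InformationPercolationEngine copy as its literal type. -/
theorem LocalSecondLaw_proof_ipe : InformationPercolationEngine.LocalSecondLaw :=
  LocalSecondLaw_of stub_historyNet stub_pinnedRepresentation stub_exchangePairing stub_relativeOddChaos
    stub_maxwellisation stub_entropyFluxClosure stub_initialMatching

end Composition

/-! ## § Lead c11 — audit of K1 `stub_relativeOddChaos` (kernel-checked facts for the line record)

1. `relOddChaos_integrand_identity`: POINTWISE, with no positivity and no involution property,
   `(q̃R̂ − q̃)·ψ_odd + J/2 = (q̃R̂ − q̃)(log b∘R̂ − log b)/2` — so K1 at contrast level `κ = 1` is exactly the pointwise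
   sign of the BOOKED production integrand (`relOddChaosPtwise_one_iff`), and lower levels `κ < 1` are stronger
   (`relOddChaosPtwise_mono`, on the Gibbs set where `J ≥ 0`).
2. The composition consumes K1 only through `κ ≤ 1` and only after integration: the INTEGRATED sign stub
   `Stubs.stub_bookedProductionSign` (`−η/2 ≤ P_R` for every admissible density pair of the conditioned law) is implied by
   K1 (`bookedProductionSign_of_relativeOddChaos`) and ALREADY closes the crux with the other six stubs
   (`LocalSecondLaw_of_integratedSign`).  The relative / parity-resolved / contrast-level dressing of K1 is idle for the
   crux; what is load-bearing is an all-`τ` sign statement on the contact statistics of pinned tilted local-Gibbs laws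
   under the deterministic flow — the recorded-dead class (ii) (S6 `stub_localNetProduction` of
   `Lines/kinetic-supersolution-kn-budget-dead.md`, moved from the empirical collision functional to the ensemble contact
   density). -/

section LeadAuditK1

/-- Pointwise algebra behind K1: the K1 integrand plus half the Jeffreys integrand is half the booked-production
integrand `(q̃R̂ − q̃)(log b∘R̂ − log b)`. No positivity, no property of `R̂` is used. -/
theorem relOddChaos_integrand_identity {X : Type*} (J : X → X) (q b : X → ℝ) (x : X) :
    (q (J x) - q x) * oddPart J (logCorr q b) x + jeffreysIntegrand J q x / 2 =
      (q (J x) - q x) * (Real.log (b (J x)) - Real.log (b x)) / 2 := by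
  unfold oddPart logCorr jeffreysIntegrand
  ring

/-- **K1 at contrast level `κ = 1` is the pointwise sign of the booked production** (a.e. on the bundle):
`RelOddChaosPtwise … 1 e ↔ ∀ᵐ p, −e p ≤ (q̃(R̂p) − q̃ p)(log b(R̂p) − log b p)/2`. -/
theorem relOddChaosPtwise_one_iff {σ r τ : ℝ} {φ : ℝ → T3 → ℝ} {q : Bundle → ℝ} {f : Pt1 → ℝ} {N : ℕ}
    {e : Bundle → ℝ} :
    RelOddChaosPtwise σ r τ φ q f N 1 e ↔
      ∀ᵐ p ∂(bundleMeasure τ), -e p ≤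
        (qW r φ q (Rhat p) - qW r φ q p) *
          (Real.log (bRef (hsDiameter σ N) f (Rhat p)) - Real.log (bRef (hsDiameter σ N) f p)) / 2 := by
  unfold RelOddChaosPtwise
  constructor <;> intro h <;> filter_upwards [h] with p hp
  · have hid := relOddChaos_integrand_identity Rhat (qW r φ q) (bRef (hsDiameter σ N) f) p
    linarith
  · have hid := relOddChaos_integrand_identity Rhat (qW r φ q) (bRef (hsDiameter σ N) f) p
    linarith

/-- **K1 is monotone in the contrast level** on the Gibbs set: if `J ≥ 0` a.e. (true under the a.e. Gibbs condition of
`Admissible`, `jeffreysIntegrand_nonneg`), then K1 at level `κ` implies K1 at every level `κ' ≥ κ`; in particular every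
`κ < 1` version implies the `κ = 1` version, which is all the composition uses. -/
theorem relOddChaosPtwise_mono {σ r τ : ℝ} {φ : ℝ → T3 → ℝ} {q : Bundle → ℝ} {f : Pt1 → ℝ} {N : ℕ}
    {e : Bundle → ℝ} {κ κ' : ℝ} (hκ : κ ≤ κ')
    (hJ : ∀ᵐ p ∂(bundleMeasure τ), 0 ≤ jeffreysIntegrand Rhat (qW r φ q) p)
    (h : RelOddChaosPtwise σ r τ φ q f N κ e) : RelOddChaosPtwise σ r τ φ q f N κ' e := by
  unfold RelOddChaosPtwise at h ⊢
  filter_upwards [h, hJ] with p hp hJp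
  have : κ * (jeffreysIntegrand Rhat (qW r φ q) p / 2) ≤ κ' * (jeffreysIntegrand Rhat (qW r φ q) p / 2) :=
    mul_le_mul_of_nonneg_right hκ (by linarith)
  linarith

/-- **The slack `e` of K1 is sign-free, so the POINTWISE form carries no more than the INTEGRATED one**
(observation of the parallel lead seat a5, made kernel-checked here): whenever the Jeffreys integrand `J` and the
K1 integrand `X = (q̃R̂ − q̃)ψ_odd` are integrable and the integrated inequality `−κ·∫J/2 − ∫X ≤ η` holds, K1's
`∃ e, Integrable e ∧ ∫ e ≤ η ∧ RelOddChaosPtwise … κ e` holds — with `e := −κJ/2 − X` and pointwise EQUALITY. -/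
theorem relOddChaosPtwise_of_integrated {σ r τ : ℝ} {φ : ℝ → T3 → ℝ} {q : Bundle → ℝ} {f : Pt1 → ℝ} {N : ℕ}
    {κ η : ℝ}
    (hJ : Integrable (fun p => jeffreysIntegrand Rhat (qW r φ q) p) (bundleMeasure τ))
    (hX : Integrable (fun p => (qW r φ q (Rhat p) - qW r φ q p) *
      oddPart Rhat (logCorr (qW r φ q) (bRef (hsDiameter σ N) f)) p) (bundleMeasure τ))
    (hint : -(κ * ((∫ p, jeffreysIntegrand Rhat (qW r φ q) p ∂(bundleMeasure τ)) / 2)) -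
      (∫ p, (qW r φ q (Rhat p) - qW r φ q p) *
        oddPart Rhat (logCorr (qW r φ q) (bRef (hsDiameter σ N) f)) p ∂(bundleMeasure τ)) ≤ η) :
    ∃ e : Bundle → ℝ, Integrable e (bundleMeasure τ) ∧
      ∫ p, e p ∂(bundleMeasure τ) ≤ η ∧ RelOddChaosPtwise σ r τ φ q f N κ e := by
  refine ⟨fun p => -(κ * (jeffreysIntegrand Rhat (qW r φ q) p / 2)) -
      (qW r φ q (Rhat p) - qW r φ q p) * oddPart Rhat (logCorr (qW r φ q) (bRef (hsDiameter σ N) f)) p,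
    ((hJ.div_const 2).const_mul κ).neg.sub hX, ?_, ?_⟩
  · have h1 : Integrable (fun p => -(κ * (jeffreysIntegrand Rhat (qW r φ q) p / 2))) (bundleMeasure τ) :=
      ((hJ.div_const 2).const_mul κ).neg
    rw [integral_sub h1 hX, integral_neg, integral_const_mul, integral_div]
    exact hint
  · exact ae_of_all _ fun p => by linarith

/-- On the Gibbs set of an admissible pair the Jeffreys integrand is a.e. non-negative. -/
theorem Admissible.jeffreys_nonneg_ae {σ r τ : ℝ} {φ : ℝ → T3 → ℝ} {q : Bundle → ℝ} {f : Pt1 → ℝ} {N : ℕ}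
    (hAdm : Admissible σ r τ φ q f N) :
    ∀ᵐ p ∂(bundleMeasure τ), 0 ≤ jeffreysIntegrand Rhat (qW r φ q) p := by
  obtain ⟨-, -, -, -, hq⟩ := hAdm
  have hqJ : ∀ᵐ p ∂(bundleMeasure τ), 0 ≤ qW r φ q (Rhat p) ∧ (qW r φ q (Rhat p) = 0 ↔ qW r φ q (Rhat (Rhat p)) = 0) :=
    (measurePreserving_Rhat τ).quasiMeasurePreserving.tendsto_ae.eventually hq
  filter_upwards [hq, hqJ] with p hp hpJ
  exact jeffreysIntegrand_nonneg hp.1 hpJ.1 hp.2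

/-- **The INTEGRATED sign stub** — what the composition actually consumes from K1: for every admissible density pair of
the conditioned law on a pinned cell, the booked production `P_R` is `≥ −η/2`.  An all-`τ` sign statement on contact
statistics of deterministic spheres (ensemble form of the recorded-dead S6 `stub_localNetProduction`). -/
def Stubs.stub_bookedProductionSign : Prop :=
  EnsFrame fun σ r τ η φ _ _ N Φ μ S =>
    ∀ f q, IsOneParticleDensity τ (condLaw μ S) Φ f → IsContactDensity τ (condLaw μ S) Φ q →
      Admissible σ r τ φ q f N → -(η / 2) ≤ prodR σ r τ φ q f N

/-- K1 implies the integrated sign stub (via the proved kernel `prodR_ge_of_relativeOddChaos`, `κ < 1 ⇒ κ ≤ 1`). -/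
theorem bookedProductionSign_of_relativeOddChaos (hK1 : Stubs.stub_relativeOddChaos) :
    Stubs.stub_bookedProductionSign := by
  intro a₀ θ₀ u₀ ha hθ hu ha0 hθ0
  obtain ⟨σK, hσK, HK⟩ := hK1 a₀ θ₀ u₀ ha hθ hu ha0 hθ0
  refine ⟨σK, hσK, fun σ hσ hσlt T ρ θ u hE Φ hLLN hT τ hτ φ hφ hφ0 hsupp η hη => ?_⟩
  obtain ⟨κ, hκ1, HKκ⟩ := HK σ hσ hσlt
  obtain ⟨η', hη', r₀, hr₀, H⟩ := HKκ T ρ θ u hE Φ hLLN hT τ hτ φ hφ hφ0 hsupp η hη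
  refine ⟨η', hη', r₀, hr₀, fun r hr hrlt δ'' hδ'' => ?_⟩
  obtain ⟨N₀, HN⟩ := H r hr hrlt δ'' hδ''
  refine ⟨N₀, fun N hN S hS c hc f q hf hq hAdm => ?_⟩
  obtain ⟨e, he, heη, hptw⟩ := HN N hN S hS c hc f q hf hq
  exact prodR_ge_of_relativeOddChaos hAdm hκ1.le he heη hptw

/-- **The crux from the six other stubs and the INTEGRATED sign stub alone** (kernel-checked): the pointwise,
parity-resolved, contrast-level-`κ` content of K1 is idle for `LocalSecondLaw`; the composition runs verbatim with
`Stubs.stub_bookedProductionSign` in place of K1. -/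
theorem LocalSecondLaw_of_integratedSign (hT : Stubs.stub_historyNet) (hQ : Stubs.stub_pinnedRepresentation)
    (hS : Stubs.stub_exchangePairing) (hP : Stubs.stub_bookedProductionSign) (hM : Stubs.stub_maxwellisation)
    (hK4 : Stubs.stub_entropyFluxClosure) (hB : Stubs.stub_initialMatching) :
    InformationPercolationEngine.LocalSecondLaw := by
  intro a₀ θ₀ u₀ ha hθ hu ha0 hθ0
  obtain ⟨σT, hσT, HT⟩ := hT a₀ θ₀ u₀ ha hθ hu ha0 hθ0
  obtain ⟨σQ, hσQ, HQ⟩ := hQ a₀ θ₀ u₀ ha hθ hu ha0 hθ0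
  obtain ⟨σS, hσS, HS⟩ := hS a₀ θ₀ u₀ ha hθ hu ha0 hθ0
  obtain ⟨σK, hσK, HK⟩ := hP a₀ θ₀ u₀ ha hθ hu ha0 hθ0
  obtain ⟨σM, hσM, HM⟩ := hM a₀ θ₀ u₀ ha hθ hu ha0 hθ0
  obtain ⟨σF, hσF, HF⟩ := hK4 a₀ θ₀ u₀ ha hθ hu ha0 hθ0
  obtain ⟨σB, hσB, HB⟩ := hB a₀ θ₀ u₀ ha hθ hu ha0 hθ0
  refine ⟨min (min (min σT σQ) (min σS σK)) (min (min σM σF) (min σB (1 / 2))), by positivity, ?_⟩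
  intro σ hσ hσlt T ρ θ u hE Φ hLLN hTpos τ hτ φ hφ hφ0 hsupp η δ hη hδ
  have hσT' : σ < σT := hσlt.trans_le (le_trans (min_le_left _ _) (le_trans (min_le_left _ _) (min_le_left _ _)))
  have hσQ' : σ < σQ := hσlt.trans_le (le_trans (min_le_left _ _) (le_trans (min_le_left _ _) (min_le_right _ _)))
  have hσS' : σ < σS := hσlt.trans_le (le_trans (min_le_left _ _) (le_trans (min_le_right _ _) (min_le_left _ _)))
  have hσK' : σ < σK := hσlt.trans_le (le_trans (min_le_left _ _) (le_trans (min_le_right _ _) (min_le_right _ _)))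
  have hσM' : σ < σM := hσlt.trans_le (le_trans (min_le_right _ _) (le_trans (min_le_left _ _) (min_le_left _ _)))
  have hσF' : σ < σF := hσlt.trans_le (le_trans (min_le_right _ _) (le_trans (min_le_left _ _) (min_le_right _ _)))
  have hσB' : σ < σB := hσlt.trans_le (le_trans (min_le_right _ _) (le_trans (min_le_right _ _) (min_le_left _ _)))
  have hσhalf : σ ≤ 1 / 2 :=
    (hσlt.trans_le (le_trans (min_le_right _ _) (le_trans (min_le_right _ _) (min_le_right _ _)))).le
  have hη6 : 0 < η / 6 := by positivity
  obtain ⟨ηQ, hηQ, rQ, hrQ, HQ'⟩ := HQ σ hσ hσQ' T ρ θ u hE Φ hLLN hTpos τ hτ φ hφ hφ0 hsupp (η / 6) hη6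
  obtain ⟨ηS, hηS, rS, hrS, HS'⟩ := HS σ hσ hσS' T ρ θ u hE Φ hLLN hTpos τ hτ φ hφ hφ0 hsupp (η / 6) hη6
  obtain ⟨ηK, hηK, rK, hrK, HK'⟩ := HK σ hσ hσK' T ρ θ u hE Φ hLLN hTpos τ hτ φ hφ hφ0 hsupp (η / 6) hη6
  obtain ⟨ηM, hηM, rM, hrM, HM'⟩ := HM σ hσ hσM' T ρ θ u hE Φ hLLN hTpos τ hτ φ hφ hφ0 hsupp (η / 6) hη6
  obtain ⟨ηF, hηF, rF, hrF, HF'⟩ := HF σ hσ hσF' T ρ θ u hE Φ hLLN hTpos τ hτ φ hφ hφ0 hsupp (η / 6) hη6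
  obtain ⟨ηB, hηB, rB, hrB, HB'⟩ := HB σ hσ hσB' T ρ θ u hE Φ hLLN hTpos τ hτ φ hφ hφ0 hsupp (η / 6) hη6
  set η' : ℝ := min (min ηQ (min ηS ηK)) (min ηM (min ηF ηB)) with hη'def
  have hη'pos : 0 < η' := by positivity
  have hη'Q : η' ≤ ηQ := le_trans (min_le_left _ _) (min_le_left _ _)
  have hη'S : η' ≤ ηS := le_trans (min_le_left _ _) (le_trans (min_le_right _ _) (min_le_left _ _))
  have hη'K : η' ≤ ηK := le_trans (min_le_left _ _) (le_trans (min_le_right _ _) (min_le_right _ _))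
  have hη'M : η' ≤ ηM := le_trans (min_le_right _ _) (min_le_left _ _)
  have hη'F : η' ≤ ηF := le_trans (min_le_right _ _) (le_trans (min_le_right _ _) (min_le_left _ _))
  have hη'B : η' ≤ ηB := le_trans (min_le_right _ _) (le_trans (min_le_right _ _) (min_le_right _ _))
  refine ⟨min (min rQ (min rS rK)) (min rM (min rF rB)), by positivity, ?_⟩
  intro r hr hrlt
  have hrQ' : r < rQ := hrlt.trans_le (le_trans (min_le_left _ _) (min_le_left _ _))
  have hrS' : r < rS := hrlt.trans_le (le_trans (min_le_left _ _) (le_trans (min_le_right _ _) (min_le_left _ _)))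
  have hrK' : r < rK := hrlt.trans_le (le_trans (min_le_left _ _) (le_trans (min_le_right _ _) (min_le_right _ _)))
  have hrM' : r < rM := hrlt.trans_le (le_trans (min_le_right _ _) (min_le_left _ _))
  have hrF' : r < rF := hrlt.trans_le (le_trans (min_le_right _ _) (le_trans (min_le_right _ _) (min_le_left _ _)))
  have hrB' : r < rB := hrlt.trans_le (le_trans (min_le_right _ _) (le_trans (min_le_right _ _) (min_le_right _ _)))
  have hδ2 : 0 < δ / 2 := by positivity
  obtain ⟨M, hMpos, NT, HT'⟩ := HT σ hσ hσT' Φ τ hτ η' (δ / 2) hη'pos hδ2 r hr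
  set δ'' : ℝ := δ / (2 * M) with hδ''def
  have hMreal : (0 : ℝ) < M := by exact_mod_cast hMpos
  have hδ'' : 0 < δ'' := by positivity
  obtain ⟨NQ, HQ''⟩ := HQ' r hr hrQ' δ'' hδ''
  obtain ⟨NS, HS''⟩ := HS' r hr hrS' δ'' hδ''
  obtain ⟨NK, HK''⟩ := HK' r hr hrK' δ'' hδ''
  obtain ⟨NM, HM''⟩ := HM' r hr hrM' δ'' hδ''
  obtain ⟨NF, HF''⟩ := HF' r hr hrF' δ'' hδ''
  obtain ⟨NB, HB''⟩ := HB' r hr hrB' δ'' hδ''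
  refine ⟨max (max NT (max NQ NS)) (max (max NK NM) (max NF NB)), fun N hN => ?_⟩
  have hNT : NT ≤ N := le_trans (le_trans (le_max_left _ _) (le_max_left _ _)) hN
  have hNQ : NQ ≤ N := le_trans (le_trans (le_trans (le_max_left _ _) (le_max_right _ _)) (le_max_left _ _)) hN
  have hNS : NS ≤ N := le_trans (le_trans (le_trans (le_max_right _ _) (le_max_right _ _)) (le_max_left _ _)) hN
  have hNK : NK ≤ N := le_trans (le_trans (le_trans (le_max_left _ _) (le_max_left _ _)) (le_max_right _ _)) hN
  have hNM : NM ≤ N := le_trans (le_trans (le_trans (le_max_right _ _) (le_max_left _ _)) (le_max_right _ _)) hN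
  have hNF : NF ≤ N := le_trans (le_trans (le_trans (le_max_left _ _) (le_max_right _ _)) (le_max_right _ _)) hN
  have hNB : NB ≤ N := le_trans (le_trans (le_trans (le_max_right _ _) (le_max_right _ _)) (le_max_right _ _)) hN
  set μ : Measure (Phase N) := localGibbsLaw σ a₀ u₀ θ₀ N (Φ N) with hμdef
  haveI : IsProbabilityMeasure μ := isProbabilityMeasure_localGibbsLaw ha hθ hu ha0 hθ0 hσhalf N (Φ N)
  set initE : ℝ := ∫ x : T3, Hs σ (ρ 0 x) (θ 0 x) * φ 0 x with hinitE
  set Bad : Set (Phase N) := {z | entropyFunctional σ r τ φ (Φ N) z + initE < -η} with hBad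
  change μ Bad ≤ ENNReal.ofReal δ
  by_contra hcon
  obtain ⟨c, hc⟩ := HT' N hNT
  obtain ⟨j, hj⟩ := exists_cell_of_measure_gt μ hMpos Bad {z | ∀ j : Fin M, z ∉ Pin σ r τ η' (Φ N) (c j)}
    (fun j => Pin σ r τ η' (Φ N) (c j)) hδ (subset_exceptional_union Bad _) hc hcon
  set S : Set (Phase N) := Bad ∩ Pin σ r τ η' (Φ N) (c j) with hSdef
  have hSmass : ENNReal.ofReal δ'' ≤ μ S := by rw [hδ''def]; exact hj
  have hSpin : ∀ {η₂ : ℝ}, η' ≤ η₂ → S ⊆ Pin σ r τ η₂ (Φ N) (c j) :=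
    fun h => (Set.inter_subset_right).trans (Pin_mono h (Φ N) (c j))
  have EQ := HQ'' N hNQ S hSmass (c j) (hSpin hη'Q)
  have ES := HS'' N hNS S hSmass (c j) (hSpin hη'S)
  have EK := HK'' N hNK S hSmass (c j) (hSpin hη'K)
  have EM := HM'' N hNM S hSmass (c j) (hSpin hη'M)
  have EF := HF'' N hNF S hSmass (c j) (hSpin hη'F)
  have EB := HB'' N hNB S hSmass (c j) (hSpin hη'B)
  obtain ⟨f, q, hf, hq, hAdm, hXi⟩ := ES
  have hP : -((η / 6) / 2) ≤ prodR σ r τ φ q f N := EK f q hf hq hAdm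
  have hMg := EM f hf
  have hFg := EF f hf
  have hBg := EB f hf
  have hLedger := ensFunctional_add_init_eq σ r τ φ f (condLaw μ S) (Φ N) (ρ 0) (θ 0)
  have hEns : -η + η / 6 ≤ ensFunctional σ r τ φ (condLaw μ S) (Φ N) + initE := by
    rw [hinitE, hLedger]
    have h1 := (abs_le.1 hMg).1
    have h2 := (abs_le.1 hFg).1
    have h3 := (abs_le.1 hBg).1
    linarith
  have hBadSub : S ⊆ {z | entropyFunctional σ r τ φ (Φ N) z <
      ensFunctional σ r τ φ (condLaw μ S) (Φ N) - η / 6} := by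
    intro z hz
    have hzB : z ∈ Bad := hz.1
    simp only [hBad, Set.mem_setOf_eq] at hzB
    simp only [Set.mem_setOf_eq]
    linarith
  have hnull : μ S = 0 := measure_eq_zero_of_two_mul_le μ S _ hBadSub EQ
  rw [hnull] at hSmass
  have : ENNReal.ofReal δ'' = 0 := nonpos_iff_eq_zero.1 hSmass
  rw [ENNReal.ofReal_eq_zero] at this
  linarith

end LeadAuditK1


end Summit.AtomisticToContinuum.HydrodynamicLimit.Cruxes.LocalSecondLaw.ContactAsymmetryInformation

end
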